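import Literature.Probability.LatticeModels.FermionicObservableSums
import Literature.Probability.LatticeModels.LatticeWalkTrace
import Literature.Probability.LatticeModels.InnerFacesHoleFree
import Literature.Probability.RandomPlanarGeometry.PolygonalDomains
import HarnessLib

/-!
# The boundary cycle and the polygonal Dobrushin domain of admissible square-lattice data

Topic `Literature/Probability/LatticeModels` (family `crit-ising`). Chelkak–Duminil-Copin–Hongler–
Kemppainen–Smirnov (C. R. Math. Acad. Sci. Paris 352 (2014), §2) work with "the polygonal domain
`Ω^δ_ℂ ⊂ ℂ` (union of tiles) corresponding to `Ω^δ ⊂ δℤ²`" and conformal maps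
`φ^δ : (Ω^δ_ℂ; a^δ, b^δ) → (𝔻; -1, +1)`; Kemppainen–Smirnov's theory of discrete random curves
(Ann. Probab. 45 (2017), §1.1, Cor. 1.8) is applied to the interface viewed as a curve in this
marked Jordan domain, read through its own uniformizing map (tree:
`ae_isLoewnerDescribable_and_tendstoInDistribution_drivingPath_varying`,
`LatticeModels.exists_observableMartingale_fkInterface_of_latticeData`, hypothesis (1)). For the
tree's canonical discretisations (`DiscreteDobrushin`, `IsZdAdmissible`: the largest component
`Ω_δ` of the mesh graph, inner faces, the two `A`–`B` edges `e_a`, `e_b`) this object has to be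
CONSTRUCTED: the union of the inner faces explored from `e_a` may have pinch vertices (thin
diagonal arms of `Ω`), its closure is not a Jordan domain in general, and the medial polyline of
the exploration touches its boundary. This file constructs the domain and proves the facts about
it that do not depend on the configuration:

* `DiscreteDobrushin.bsucc`, `bpred`, `bwalk`, `bperiod` — the LEFT-HAND BOUNDARY WALK on the
  face-boundary darts of `MedialInterfaceProofs` (`IsOutEdge x k`: inner face `k` at `x` on the
  left, non-inner face `k + 3` on the right): at the head turn left, else go straight, else turn
  right; it permutes the finitely many face-boundary darts (`bsucc_bpred`, `bpred_bsucc`), so the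
  walk from any dart is periodic and dart-simple within a period (`bwalk_injOn`); it traces the
  boundary of the union of the OPEN inner faces, going around pinch vertices.
* `DiscreteDobrushin.bloop` — a closed piece of the walk as a `ClosedWalk` of
  `LatticeLoopWinding.lean`, with its traversal counts (`cnt_bloop`), whence THE WINDING NUMBER
  JUMPS BY ONE ACROSS EVERY DART OF THE PIECE (`W_bloop_left`: inner left face = non-inner right
  face `+ 1`) and does not jump across avoided edges (`W_bloop_eq_of_forall_ne`).
* `ClosedWalk.strace`, `W_eq_zero_of_joined_far` — the trace of a (sub-)walk at mesh `δ`; the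
  combinatorial winding number `W` of a face vanishes when the cell centre is joined to infinity
  off the trace (`LatticeWalkTrace`: `W ∘ flFace` is constant along paths off the trace and zero
  far away; components of the open complement are path-connected).
* `exists_witness_of_not_isInnerFace` — a non-inner face with a corner in `Ω_δ` has a side
  leaving `closure Ω` or a corner off `Ω` (`Ω_δ` is a union of components of the mesh graph).
* REGULAR DOMAINS. Call `Ω` regular if it is open and its exterior `(closure Ω)ᶜ` is connected,
  unbounded, with `frontier Ω ⊆ closure (closure Ω)ᶜ` — true for the carrier of every Jordan
  domain by the Jordan curve theorem PROVED in the tree (`regular_of_eq_carrier`,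
  `JordanDomain.exterior_of_JCT`). The four hypotheses are carried explicitly. Then:
  `W_bloop_eq_zero_of_not_isInnerFace` (a non-inner face next to `Ω_δ` has winding number `0`
  for every closed piece: its centre is joined to the exterior through the exit witness, off the
  polygon, and the exterior reaches infinity), `W_bloop_left_eq_one`, and
  **`bwalk_fst_injOn`: THE BOUNDARY CYCLE IS VERTEX-SIMPLE** — a return to a vertex within a
  period is a pinch (darts `k`, `k + 2` out of `v`; faces `k`, `k + 2` inner, `k ± 1` not), and the
  closed sub-walk in between would give the two non-inner faces at `v` winding numbers differing
  by one, whereas both vanish.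
* `eq_or_reverse_of_halfEdge_eq` (two half-open unit lattice edges meet only if they share their
  source or are mutually reverse), whence **`isSimpleClosedPolygon_bverts`**: the vertex list
  `bverts` of one period of the cycle from `e_a` spans a simple closed polygon
  (`PolygonalDomains.IsSimpleClosedPolygon`).
* `ebDart` — the end dart `e_b` (the exit edge of every exploration, oriented from its `B`-end;
  independent of the configuration, `ebDart'_eq`, since there are exactly two `A`–`B` edges), on
  the cycle (`exists_bwalk_eq_ebDart`, at position `ebIdx > 0`), because its left face is the
  last explored face (winding number `1`, `W_bcycle_cFace_cornerOrbit`: ALONG EVERY EXPLORATION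
  THE FACES HAVE WINDING NUMBER ONE) and its right face the exit face (winding number `0`).
* **`DiscreteDobrushin.faceDomain`** — the polygonal Dobrushin domain `(Ω^δ_ℂ; a_δ, b_δ)`:
  `polygonDomain` of `bverts` (the Jordan curve theorem again, through `JordanDomain.ofLoop`)
  with marked points the midpoints of `e_a` and `e_b` (`faceDomain_pt_zero`,
  `faceDomain_pt_one`: `pt 0 = medialPoint δ e_a`, `pt 1 = medialPoint δ e_b`); the loop runs
  from the `A`-end of `e_a` across `e_a`, along the `B`-sites to `e_b`, back along the `A`-sites,
  so `arc 0` is the free/dual-wired side `(a_δ b_δ)` and `arc 1` the wired side, the convention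
  of CDHKS Thm. 2.
* `cell_subset_faceDomain_of_W_ne_zero`, `closure_cell_cornerOrbit_subset`,
  `medialPoint_cSrc_cornerOrbit_mem` — cells of faces of non-zero winding number are inside;
  in particular every explored face, and every medial vertex of every exploration lies in the
  closure of the face domain;
* `range_medialExplorationCurve_subset`, `medialExplorationCurve_apply_zero/one` — THE
  EXPLORATION POLYLINE OF EVERY CONFIGURATION (`medialExplorationCurve`, i.e. the FK polygon
  `fkPolygon` of `FKIsingInterfaceTightness.lean` before re-orientation) RUNS IN THE CLOSED FACE
  DOMAIN FROM `pt 0 = a_δ` TO `pt 1 = b_δ` (a polyline whose segments lie in a set lies in it,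
  `range_polyline_map_range_subset`);
* `faceDomain_carrier_subset_closure`, `not_ball_subset_faceDomain`,
  `faceDomain_carrier_subset_of_closure_subset` — the face domain lies in `closure Ω` (the
  exterior is connected, unbounded and misses the polygon), whence the inputs (K2) "no disc about
  a point off `Ω` lies in the face domain" and (B) "uniformly bounded" of Pommerenke's kernel
  convergence theorem (`RandomPlanarGeometry/KernelConvergenceULC.lean`) for the face domains of
  all discretisations of one domain.

Everything is proved; no named fact is introduced. Not here (next files): the describability of
the (non-simple) exploration polyline by the Loewner evolution in the face domain, and the
remaining inputs (K1) (compacts of `Ω` eventually inside) and (ULC) (uniform local connectedness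
of the complements) of the convergence of the uniformizing maps of `faceDomain (E δ)` for a
discretisation `E` of a Jordan domain.

## References

* D. Chelkak, H. Duminil-Copin, C. Hongler, A. Kemppainen, S. Smirnov, *Convergence of Ising
  interfaces to Schramm's SLE curves*, C. R. Math. Acad. Sci. Paris 352 (2014) 157–161, §2
  (the polygonal domain `Ω^δ_ℂ` and the maps `φ^δ`). [CDHKSCRAS2014]
* S. Smirnov, *Critical percolation in the plane*, C. R. Acad. Sci. Paris 333 (2001), §2 (the
  discrete Dobrushin set-up `e_a`, `e_b`, followed by `MedialInterface.lean`). [Smirnov2001]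
* A. Kemppainen, S. Smirnov, Ann. Probab. 45 (2017) 698–779, §1.1 and Cor. 1.8 (curves in
  approximating domains read through their own maps). [KemppainenSmirnov2017]
* J. McCleary, *A First Course in Topology* (2006), Ch. 9 (Jordan curve theorem; tree:
  `JordanCurveTheorem_holds`). [Mccleary2006]
-/

noncomputable section

namespace Literature.Probability.LatticeModels

open Set Metric Complex DiscreteDobrushin Literature.Topology.PlaneTopology Literature.Probability.LatticeModels.Mesh Literature.Probability.RandomPlanarGeometry

namespace DiscreteDobrushin

variable (D : DiscreteDobrushin)

open scoped Classical in
/-- **The left-hand boundary successor.** From the face-boundary dart `(x, k)` (the edge at `x`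
in direction `k`, inner face `faceAt x k` on its left, non-inner face `faceAt x (k + 3)` on its
right, `IsOutEdge`), move to its head `y = x + cornerUnit k` and continue along the first
face-boundary dart sourced at `y` in the order left turn (`k + 1`), straight on (`k`), right turn
(`k + 3`): the boundary of the union of the OPEN inner faces is followed keeping it on the left.
[folklore] -/
noncomputable def bsucc (p : Site 2 × Fin 4) : Site 2 × Fin 4 :=
  if D.IsOutEdge (p.1 + cornerUnit p.2) (p.2 + 1) then (p.1 + cornerUnit p.2, p.2 + 1)
  else if D.IsOutEdge (p.1 + cornerUnit p.2) p.2 then (p.1 + cornerUnit p.2, p.2)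
  else (p.1 + cornerUnit p.2, p.2 + 3)

open scoped Classical in
/-- **The left-hand boundary predecessor** of the face-boundary dart `(y, k')`: the dart into `y`
from which the left-hand rule continues along `(y, k')`, read off the faces `k' + 1`, `k' + 2`
around `y`. [folklore] -/
noncomputable def bpred (q : Site 2 × Fin 4) : Site 2 × Fin 4 :=
  if D.IsInnerFace (faceAt q.1 (q.2 + 1)) then
    (if D.IsInnerFace (faceAt q.1 (q.2 + 2)) then (q.1 + cornerUnit (q.2 + 3), q.2 + 1)
      else (q.1 + cornerUnit (q.2 + 2), q.2))
  else (q.1 + cornerUnit (q.2 + 1), q.2 + 3)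

variable {D}

/-- The successor dart is sourced at the head of the current one. [folklore] -/
theorem bsucc_fst (p : Site 2 × Fin 4) : (D.bsucc p).1 = p.1 + cornerUnit p.2 := by
  unfold bsucc
  split_ifs <;> rfl

/-- `k + 3 + 2 = k + 1` in `Fin 4`. [folklore] -/
theorem fin4_three_two (k : Fin 4) : k + 3 + 2 = k + 1 := by revert k; decide

/-- `x + cornerUnit k + cornerUnit (k + 2) = x`. [folklore] -/
theorem add_cornerUnit_add_cornerUnit_add_two (x : Site 2) (k : Fin 4) :
    x + cornerUnit k + cornerUnit (k + 2) = x := by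
  rw [cornerUnit_add_two, add_neg_cancel_right]

/-- `x + cornerUnit (k + 2) + cornerUnit k = x`. [folklore] -/
theorem add_cornerUnit_add_two_add_cornerUnit (x : Site 2) (k : Fin 4) :
    x + cornerUnit (k + 2) + cornerUnit k = x := by
  rw [cornerUnit_add_two, neg_add_cancel_right]

/-- **The successor of a face-boundary dart is a face-boundary dart.** [folklore] -/
theorem isOutEdge_bsucc {p : Site 2 × Fin 4} (h : D.IsOutEdge p.1 p.2) :
    D.IsOutEdge (D.bsucc p).1 (D.bsucc p).2 := by
  have h1 : D.IsInnerFace (faceAt (p.1 + cornerUnit p.2) (p.2 + 1)) := by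
    rw [faceAt_add_unit_succ]; exact h.1
  have h2 : ¬ D.IsInnerFace (faceAt (p.1 + cornerUnit p.2) (p.2 + 2)) := by
    rw [faceAt_add_unit_add_two]; exact h.2
  unfold bsucc
  split_ifs with ha hb
  · exact ha
  · exact hb
  · simp only [IsOutEdge, not_and, not_not] at ha hb
    have hk : D.IsInnerFace (faceAt (p.1 + cornerUnit p.2) p.2) := by
      have := ha h1; rwa [fin4_add_one_add_three] at this
    refine ⟨hb hk, ?_⟩
    rwa [fin4_add_three_add_three]

/-- `bsucc ∘ bpred = id` on face-boundary darts. [folklore] -/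
theorem bsucc_bpred {q : Site 2 × Fin 4} (hq : D.IsOutEdge q.1 q.2) : D.bsucc (D.bpred q) = q := by
  obtain ⟨y, k⟩ := q
  simp only at hq
  by_cases ha : D.IsInnerFace (faceAt y (k + 1))
  · by_cases hb : D.IsInnerFace (faceAt y (k + 2))
    · -- right-turn predecessor `(y + u_{k+3}, k+1)`
      unfold bpred
      simp only
      rw [if_pos ha, if_pos hb]
      unfold bsucc
      simp only
      have hy : y + cornerUnit (k + 3) + cornerUnit (k + 1) = y := by
        have := add_cornerUnit_add_two_add_cornerUnit y (k + 1)
        rwa [fin4_add_one_add_two] at this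
      have h1 : ¬ D.IsOutEdge y (k + 2) := fun h' => h'.2 (by rw [fin4_add_two_add_three]; exact ha)
      have h2 : ¬ D.IsOutEdge y (k + 1) := fun h' => h'.2 (by rw [fin4_add_one_add_three]; exact hq.1)
      rw [hy, fin4_add_one_add_one, if_neg h1, if_neg h2, fin4_add_one_add_three]
    · -- straight predecessor `(y + u_{k+2}, k)`
      unfold bpred
      simp only
      rw [if_pos ha, if_neg hb]
      unfold bsucc
      simp only
      have h1 : ¬ D.IsOutEdge y (k + 1) := fun h' => h'.2 (by rw [fin4_add_one_add_three]; exact hq.1)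
      rw [add_cornerUnit_add_two_add_cornerUnit, if_neg h1, if_pos hq]
  · -- left-turn predecessor `(y + u_{k+1}, k+3)`
    unfold bpred
    simp only
    rw [if_neg ha]
    unfold bsucc
    simp only
    have hy : y + cornerUnit (k + 1) + cornerUnit (k + 3) = y := by
      have := add_cornerUnit_add_cornerUnit_add_two y (k + 1)
      rwa [fin4_add_one_add_two] at this
    rw [hy, fin4_add_three_add_one, if_pos hq]

/-- `bpred ∘ bsucc = id` on face-boundary darts. [folklore] -/
theorem bpred_bsucc {p : Site 2 × Fin 4} (hp : D.IsOutEdge p.1 p.2) : D.bpred (D.bsucc p) = p := by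
  obtain ⟨x, k⟩ := p
  simp only at hp
  have h1 : D.IsInnerFace (faceAt (x + cornerUnit k) (k + 1)) := by
    rw [faceAt_add_unit_succ]; exact hp.1
  have h2 : ¬ D.IsInnerFace (faceAt (x + cornerUnit k) (k + 2)) := by
    rw [faceAt_add_unit_add_two]; exact hp.2
  unfold bsucc
  simp only
  split_ifs with ha hb
  · unfold bpred
    simp only
    rw [fin4_add_one_add_one, if_neg h2, fin4_add_one_add_three, add_cornerUnit_add_cornerUnit_add_two]
  · unfold bpred
    simp only
    rw [if_pos h1, if_neg h2, add_cornerUnit_add_cornerUnit_add_two]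
  · simp only [IsOutEdge, not_and, not_not] at ha hb
    have hk : D.IsInnerFace (faceAt (x + cornerUnit k) k) := by
      have := ha h1; rwa [fin4_add_one_add_three] at this
    unfold bpred
    simp only
    rw [fin4_add_three_add_one, if_pos hk, fin4_three_two, if_pos h1, fin4_add_three_add_three,
      add_cornerUnit_add_cornerUnit_add_two]

/-- **The left-hand successor is injective on face-boundary darts.** [folklore] -/
theorem bsucc_injOn {p q : Site 2 × Fin 4} (hp : D.IsOutEdge p.1 p.2) (hq : D.IsOutEdge q.1 q.2)
    (h : D.bsucc p = D.bsucc q) : p = q := by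
  rw [← bpred_bsucc hp, h, bpred_bsucc hq]

/-! ### The boundary walk from a dart -/

variable (D) in
/-- The orbit of the left-hand successor from the dart `d₀`. [folklore] -/
noncomputable def bwalk (d₀ : Site 2 × Fin 4) : ℕ → Site 2 × Fin 4
  | 0 => d₀
  | n + 1 => D.bsucc (bwalk d₀ n)

variable {d₀ : Site 2 × Fin 4}

/-- The walk starts at `d₀`. [folklore] -/
@[simp] theorem bwalk_zero : D.bwalk d₀ 0 = d₀ := rfl

/-- The walk steps by the successor. [folklore] -/
theorem bwalk_succ (n : ℕ) : D.bwalk d₀ (n + 1) = D.bsucc (D.bwalk d₀ n) := rfl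

/-- Along the walk every dart is a face-boundary dart. [folklore] -/
theorem isOutEdge_bwalk (h₀ : D.IsOutEdge d₀.1 d₀.2) (n : ℕ) :
    D.IsOutEdge (D.bwalk d₀ n).1 (D.bwalk d₀ n).2 := by
  induction n with
  | zero => exact h₀
  | succ n ih => exact isOutEdge_bsucc ih

/-- The vertices of the walk step by the unit vectors of the darts. [folklore] -/
theorem bwalk_fst_succ (n : ℕ) : (D.bwalk d₀ (n + 1)).1 = (D.bwalk d₀ n).1 + cornerUnit (D.bwalk d₀ n).2 := by
  rw [bwalk_succ, bsucc_fst]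

/-- Cancelling equal steps along the walk. [folklore] -/
theorem bwalk_eq_of_add_eq (h₀ : D.IsOutEdge d₀.1 d₀.2) {i j : ℕ} (d : ℕ)
    (h : D.bwalk d₀ (i + d) = D.bwalk d₀ (j + d)) : D.bwalk d₀ i = D.bwalk d₀ j := by
  induction d with
  | zero => exact h
  | succ d ih =>
    exact ih (bsucc_injOn (isOutEdge_bwalk h₀ _) (isOutEdge_bwalk h₀ _) h)

/-- Face-boundary darts are finitely many (their left faces are inner). [folklore] -/
theorem finite_isOutEdge (hD : D.IsZdAdmissible) : {p : Site 2 × Fin 4 | D.IsOutEdge p.1 p.2}.Finite :=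
  (finite_innerCorners hD).subset fun _ hp => hp.1

/-- **The boundary walk is periodic.** [folklore] -/
theorem exists_bwalk_period (hD : D.IsZdAdmissible) (h₀ : D.IsOutEdge d₀.1 d₀.2) :
    ∃ P, 0 < P ∧ D.bwalk d₀ P = d₀ := by
  obtain ⟨i, j, hij, h⟩ := (finite_isOutEdge hD).exists_lt_map_eq_of_forall_mem
    (f := D.bwalk d₀) (isOutEdge_bwalk h₀)
  refine ⟨j - i, by omega, ?_⟩
  have := bwalk_eq_of_add_eq h₀ (i := 0) (j := j - i) i
    (by rwa [zero_add, Nat.sub_add_cancel hij.le])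
  exact this.symm

open scoped Classical in
/-- **The period** of the boundary walk: the first return time to `d₀`. [folklore] -/
noncomputable def bperiod (hD : D.IsZdAdmissible) (h₀ : D.IsOutEdge d₀.1 d₀.2) : ℕ :=
  Nat.find (exists_bwalk_period hD h₀)

/-- The period is positive. [folklore] -/
theorem bperiod_pos (hD : D.IsZdAdmissible) (h₀ : D.IsOutEdge d₀.1 d₀.2) : 0 < bperiod hD h₀ := by
  classical
  exact (Nat.find_spec (exists_bwalk_period hD h₀)).1

/-- After one period the walk is back at `d₀`. [folklore] -/
theorem bwalk_bperiod (hD : D.IsZdAdmissible) (h₀ : D.IsOutEdge d₀.1 d₀.2) :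
    D.bwalk d₀ (bperiod hD h₀) = d₀ := by
  classical
  exact (Nat.find_spec (exists_bwalk_period hD h₀)).2

/-- No earlier positive time returns to `d₀`. [folklore] -/
theorem bwalk_ne_of_lt_bperiod (hD : D.IsZdAdmissible) (h₀ : D.IsOutEdge d₀.1 d₀.2) {m : ℕ}
    (hm0 : 0 < m) (hm : m < bperiod hD h₀) : D.bwalk d₀ m ≠ d₀ := by
  classical
  intro h
  exact Nat.find_min (exists_bwalk_period hD h₀) hm ⟨hm0, h⟩

/-- The walk is periodic with its period. [folklore] -/
theorem bwalk_add_bperiod (hD : D.IsZdAdmissible) (h₀ : D.IsOutEdge d₀.1 d₀.2) (n : ℕ) :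
    D.bwalk d₀ (n + bperiod hD h₀) = D.bwalk d₀ n := by
  induction n with
  | zero => rw [zero_add, bwalk_bperiod]; rfl
  | succ n ih => rw [Nat.succ_add, bwalk_succ, bwalk_succ, ih]

/-- The walk is periodic with any multiple of its period. [folklore] -/
theorem bwalk_add_mul_bperiod (hD : D.IsZdAdmissible) (h₀ : D.IsOutEdge d₀.1 d₀.2) (n m : ℕ) :
    D.bwalk d₀ (n + m * bperiod hD h₀) = D.bwalk d₀ n := by
  induction m with
  | zero => simp
  | succ m ih => rw [Nat.succ_mul, ← add_assoc, bwalk_add_bperiod, ih]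

/-- Position `n` equals position `n % P`. [folklore] -/
theorem bwalk_mod_bperiod (hD : D.IsZdAdmissible) (h₀ : D.IsOutEdge d₀.1 d₀.2) (n : ℕ) :
    D.bwalk d₀ (n % bperiod hD h₀) = D.bwalk d₀ n := by
  conv_rhs => rw [← Nat.mod_add_div n (bperiod hD h₀), mul_comm]
  exact (bwalk_add_mul_bperiod hD h₀ _ _).symm

/-- **Within a period the darts are distinct.** [folklore] -/
theorem bwalk_injOn (hD : D.IsZdAdmissible) (h₀ : D.IsOutEdge d₀.1 d₀.2) {i j : ℕ}
    (hi : i < bperiod hD h₀) (hj : j < bperiod hD h₀) (h : D.bwalk d₀ i = D.bwalk d₀ j) : i = j := by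
  wlog hij : i ≤ j generalizing i j
  · exact (this hj hi h.symm (le_of_not_ge hij)).symm
  rcases hij.eq_or_lt with rfl | hlt
  · rfl
  · exfalso
    have h' : D.bwalk d₀ (0 + i) = D.bwalk d₀ ((j - i) + i) := by
      rwa [zero_add, Nat.sub_add_cancel hlt.le]
    have := bwalk_eq_of_add_eq h₀ i h'
    exact bwalk_ne_of_lt_bperiod hD h₀ (m := j - i) (by omega) (by omega) this.symm

/-- Darts with the same index modulo the period coincide, and conversely. [folklore] -/
theorem bwalk_eq_iff_mod_eq (hD : D.IsZdAdmissible) (h₀ : D.IsOutEdge d₀.1 d₀.2) (i j : ℕ) :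
    D.bwalk d₀ i = D.bwalk d₀ j ↔ i % bperiod hD h₀ = j % bperiod hD h₀ := by
  constructor
  · intro h
    rw [← bwalk_mod_bperiod hD h₀ i, ← bwalk_mod_bperiod hD h₀ j] at h
    exact bwalk_injOn hD h₀ (Nat.mod_lt _ (bperiod_pos hD h₀)) (Nat.mod_lt _ (bperiod_pos hD h₀)) h
  · intro h
    rw [← bwalk_mod_bperiod hD h₀ i, h, bwalk_mod_bperiod]

/-- The reverse of a dart of the walk is not a dart of the walk (a face-boundary edge is sourced
at exactly one of its endpoints). [folklore] -/
theorem bwalk_ne_reverse (h₀ : D.IsOutEdge d₀.1 d₀.2) {x : Site 2} {k : Fin 4}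
    (hx : D.IsOutEdge x k) (j : ℕ) : D.bwalk d₀ j ≠ (x + cornerUnit k, k + 2) := by
  intro h
  have h1 := isOutEdge_bwalk h₀ j
  rw [h] at h1
  have h2 := (isOutEdge_iff_isInEdge _ _).1 h1
  rw [add_cornerUnit_add_cornerUnit_add_two, fin4_add_two_add_two'] at h2
  exact hx.not_isInEdge h2

end DiscreteDobrushin

/-! ### Sites as integer pairs -/

/-- A site of `ℤ²` (a map `Fin 2 → ℤ`) as a pair of integers, the format of `ClosedWalk`.
[folklore] -/
def toZ2 (x : Site 2) : ℤ × ℤ := (x 0, x 1)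

/-- `toZ2` in coordinates. [folklore] -/
@[simp] theorem toZ2_mk (x : Site 2) : toZ2 x = (x 0, x 1) := rfl

/-- `toZ2` is injective. [folklore] -/
theorem toZ2_injective : Function.Injective toZ2 := by
  intro x y h
  simp only [toZ2_mk, Prod.mk.injEq] at h
  funext i
  fin_cases i
  · exact h.1
  · exact h.2

/-- A unit step of `Site 2` is a unit step of `ℤ × ℤ`. [folklore] -/
theorem toZ2_add_cornerUnit (x : Site 2) (k : Fin 4) :
    toZ2 (x + cornerUnit k) = toZ2 x + RectLoop.dir k := by
  fin_cases k <;> simp [cornerUnit, RectLoop.dir]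

/-- East neighbour in coordinates. [folklore] -/
theorem toZ2_add_cornerUnit_zero (x : Site 2) : toZ2 (x + cornerUnit 0) = (x 0 + 1, x 1) := by
  rw [toZ2_add_cornerUnit]; simp [RectLoop.dir]

/-- North neighbour in coordinates. [folklore] -/
theorem toZ2_add_cornerUnit_one (x : Site 2) : toZ2 (x + cornerUnit 1) = (x 0, x 1 + 1) := by
  rw [toZ2_add_cornerUnit]; simp [RectLoop.dir]

/-- West neighbour in coordinates. [folklore] -/
theorem toZ2_add_cornerUnit_two (x : Site 2) : toZ2 (x + cornerUnit 2) = (x 0 - 1, x 1) := by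
  rw [toZ2_add_cornerUnit]; simp [RectLoop.dir, sub_eq_add_neg]

/-- South neighbour in coordinates. [folklore] -/
theorem toZ2_add_cornerUnit_three (x : Site 2) : toZ2 (x + cornerUnit 3) = (x 0, x 1 - 1) := by
  rw [toZ2_add_cornerUnit]; simp [RectLoop.dir, sub_eq_add_neg]

/-- The face `0` at `x` (north-east) in coordinates. [folklore] -/
theorem toZ2_faceAt_zero (x : Site 2) : toZ2 (faceAt x 0) = (x 0, x 1) := by
  simp [faceAt, cornerOff]

/-- The face `1` at `x` (north-west) in coordinates. [folklore] -/
theorem toZ2_faceAt_one (x : Site 2) : toZ2 (faceAt x 1) = (x 0 - 1, x 1) := by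
  simp [faceAt, cornerOff]

/-- The face `2` at `x` (south-west) in coordinates. [folklore] -/
theorem toZ2_faceAt_two (x : Site 2) : toZ2 (faceAt x 2) = (x 0 - 1, x 1 - 1) := by
  simp [faceAt, cornerOff]

/-- The face `3` at `x` (south-east) in coordinates. [folklore] -/
theorem toZ2_faceAt_three (x : Site 2) : toZ2 (faceAt x 3) = (x 0, x 1 - 1) := by
  simp [faceAt, cornerOff]


/-! ### Closed lattice walks cut out of the boundary walk -/

namespace DiscreteDobrushin

variable {D : DiscreteDobrushin} {d₀ : Site 2 × Fin 4}

/-- Index bookkeeping for closing up a piece of the walk: the vertex after position `t % m` is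
the vertex at position `(t + 1) % m`, given that the piece closes up. [folklore] -/
theorem bwalk_fst_wrap {i m : ℕ} (hm : 0 < m) (hcl : (D.bwalk d₀ (i + m)).1 = (D.bwalk d₀ i).1)
    (t : ℕ) : (D.bwalk d₀ (i + (t + 1) % m)).1 = (D.bwalk d₀ (i + t % m + 1)).1 := by
  have key : (t + 1) % m = (t % m + 1) % m := (Nat.mod_add_mod t m 1).symm
  rcases Nat.lt_or_ge (t % m + 1) m with h | h
  · rw [key, Nat.mod_eq_of_lt h, Nat.add_assoc]
  · have htm : t % m + 1 = m := le_antisymm (Nat.mod_lt t hm) h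
    rw [key, htm, Nat.mod_self, Nat.add_zero, Nat.add_assoc, htm, hcl]

/-- **A closed piece of the boundary walk as a closed lattice walk.** The darts
`bwalk d₀ (i + t)`, `t < m`, followed through their vertices, closed up by the hypothesis that
the dart `bwalk d₀ (i + m)` is sourced at the vertex of `bwalk d₀ i` (for `i = 0` and `m` the
period this is the whole boundary cycle; a proper return of the vertex sequence gives a closed
sub-walk). [folklore] -/
noncomputable def bloop (i m : ℕ) (hm : 0 < m) (hcl : (D.bwalk d₀ (i + m)).1 = (D.bwalk d₀ i).1) :
    ClosedWalk m where
  v t := toZ2 (D.bwalk d₀ (i + t % m)).1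
  periodic t := by simp only [Nat.add_mod_right]
  adj t := ⟨(D.bwalk d₀ (i + t % m)).2, by
    rw [← toZ2_add_cornerUnit, ← bwalk_fst_succ, bwalk_fst_wrap hm hcl]⟩

variable {i m : ℕ} {hm : 0 < m} {hcl : (D.bwalk d₀ (i + m)).1 = (D.bwalk d₀ i).1}

/-- The vertices of the closed piece. [folklore] -/
theorem bloop_v (t : ℕ) : (bloop i m hm hcl).v t = toZ2 (D.bwalk d₀ (i + t % m)).1 := rfl

/-- The vertices of the closed piece at small times. [folklore] -/
theorem bloop_v_of_lt {t : ℕ} (ht : t < m) : (bloop i m hm hcl).v t = toZ2 (D.bwalk d₀ (i + t)).1 := by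
  rw [bloop_v, Nat.mod_eq_of_lt ht]

/-- The next vertex of the closed piece is the head of the current dart. [folklore] -/
theorem bloop_v_succ (t : ℕ) : (bloop i m hm hcl).v (t + 1) =
    toZ2 ((D.bwalk d₀ (i + t % m)).1 + cornerUnit (D.bwalk d₀ (i + t % m)).2) := by
  rw [bloop_v, bwalk_fst_wrap hm hcl, bwalk_fst_succ]

/-- A step of the closed piece from `x` to `x + cornerUnit k` at time `t` means that the dart at
time `t % m` is `(x, k)`. [folklore] -/
theorem bloop_step_iff (t : ℕ) (x : Site 2) (k : Fin 4) :
    ((bloop i m hm hcl).v t = toZ2 x ∧ (bloop i m hm hcl).v (t + 1) = toZ2 (x + cornerUnit k)) ↔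
      D.bwalk d₀ (i + t % m) = (x, k) := by
  rw [bloop_v, bloop_v_succ]
  constructor
  · rintro ⟨h1, h2⟩
    have hx := toZ2_injective h1
    rw [hx] at h2
    have hk := cornerUnit_injective (add_left_cancel (toZ2_injective h2))
    exact Prod.ext hx hk
  · intro h
    rw [h]
    exact ⟨rfl, rfl⟩

/-- **Traversal counts.** The closed piece traverses the edge from `x` to `x + cornerUnit k` as
often as the dart `(x, k)` occurs among `bwalk d₀ (i + t)`, `t < m`. [folklore] -/
theorem cnt_bloop (x : Site 2) (k : Fin 4) :
    (bloop i m hm hcl).cnt (toZ2 x) (toZ2 (x + cornerUnit k)) =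
      (((Finset.range m).filter fun t => D.bwalk d₀ (i + t) = (x, k)).card : ℤ) := by
  classical
  unfold ClosedWalk.cnt
  rw [Finset.natCast_card_filter]
  refine Finset.sum_congr rfl fun t ht => ?_
  rw [Finset.mem_range] at ht
  have key := bloop_step_iff (hm := hm) (hcl := hcl) t x k
  rw [Nat.mod_eq_of_lt ht] at key
  simp only [indZ_apply, key]

/-- Within a period, the darts `bwalk d₀ (i + t)`, `t < m ≤ P`, are distinct. [folklore] -/
theorem bwalk_add_injOn (hD : D.IsZdAdmissible) (h₀ : D.IsOutEdge d₀.1 d₀.2) (hmP : m ≤ bperiod hD h₀)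
    {t t' : ℕ} (ht : t < m) (ht' : t' < m) (h : D.bwalk d₀ (i + t) = D.bwalk d₀ (i + t')) : t = t' := by
  wlog htt : t ≤ t' generalizing t t'
  · exact (this ht' ht h.symm (le_of_not_ge htt)).symm
  have key : D.bwalk d₀ (0 + (i + t)) = D.bwalk d₀ ((t' - t) + (i + t)) := by
    rwa [zero_add, show t' - t + (i + t) = i + t' by omega]
  have h2 := bwalk_eq_of_add_eq h₀ (i + t) key
  by_contra hne
  exact bwalk_ne_of_lt_bperiod hD h₀ (m := t' - t) (by omega) (by omega) h2.symm

/-- The number of occurrences of a dart in a stretch of fewer than a period is `1` or `0`.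
[folklore] -/
theorem card_filter_bwalk_add_eq (hD : D.IsZdAdmissible) (h₀ : D.IsOutEdge d₀.1 d₀.2)
    (hmP : m ≤ bperiod hD h₀) (d : Site 2 × Fin 4) :
    ((Finset.range m).filter fun t => D.bwalk d₀ (i + t) = d).card =
      if ∃ t < m, D.bwalk d₀ (i + t) = d then 1 else 0 := by
  classical
  split_ifs with h
  · obtain ⟨t, ht, htd⟩ := h
    rw [Finset.card_eq_one]
    refine ⟨t, Finset.eq_singleton_iff_unique_mem.2 ⟨?_, fun t' ht' => ?_⟩⟩
    · exact Finset.mem_filter.2 ⟨Finset.mem_range.2 ht, htd⟩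
    · rw [Finset.mem_filter, Finset.mem_range] at ht'
      exact bwalk_add_injOn hD h₀ hmP ht'.1 ht (ht'.2.trans htd.symm)
  · rw [Finset.card_eq_zero, Finset.filter_eq_empty_iff]
    intro t ht htd
    exact h ⟨t, Finset.mem_range.1 ht, htd⟩

/-- Traversal count of an edge along a dart of the piece: `1`. [folklore] -/
theorem cnt_bloop_of_exists (hD : D.IsZdAdmissible) (h₀ : D.IsOutEdge d₀.1 d₀.2)
    (hmP : m ≤ bperiod hD h₀) {x : Site 2} {k : Fin 4} (h : ∃ t < m, D.bwalk d₀ (i + t) = (x, k)) :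
    (bloop i m hm hcl).cnt (toZ2 x) (toZ2 (x + cornerUnit k)) = 1 := by
  rw [cnt_bloop, card_filter_bwalk_add_eq hD h₀ hmP, if_pos h]; rfl

/-- Traversal count of an edge along no dart of the piece: `0`. [folklore] -/
theorem cnt_bloop_of_forall_ne {x : Site 2} {k : Fin 4} (h : ∀ t < m, D.bwalk d₀ (i + t) ≠ (x, k)) :
    (bloop i m hm hcl).cnt (toZ2 x) (toZ2 (x + cornerUnit k)) = 0 := by
  rw [cnt_bloop]
  have : ((Finset.range m).filter fun t => D.bwalk d₀ (i + t) = (x, k)) = ∅ :=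
    Finset.filter_eq_empty_iff.2 fun t ht htd => h t (Finset.mem_range.1 ht) htd
  rw [this]; rfl

/-- A face-boundary edge is never traversed backwards by the piece. [folklore] -/
theorem cnt_bloop_reverse (h₀ : D.IsOutEdge d₀.1 d₀.2) {x : Site 2} {k : Fin 4}
    (hx : D.IsOutEdge x k) : (bloop i m hm hcl).cnt (toZ2 (x + cornerUnit k)) (toZ2 x) = 0 := by
  have := cnt_bloop_of_forall_ne (i := i) (m := m) (hm := hm) (hcl := hcl) (x := x + cornerUnit k)
    (k := k + 2) fun t _ => bwalk_ne_reverse h₀ hx (i + t)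
  rwa [add_cornerUnit_add_cornerUnit_add_two] at this

/-- The four elements of `Fin 4`. [folklore] -/
private theorem fin4_cases (k : Fin 4) : k = 0 ∨ k = 1 ∨ k = 2 ∨ k = 3 := by revert k; decide

/-- **The winding number jumps by one across every dart of the piece**: the inner face on the
left of a dart of the piece has winding number one more than the non-inner face on its right.
[folklore] -/
theorem W_bloop_left (hD : D.IsZdAdmissible) (h₀ : D.IsOutEdge d₀.1 d₀.2) (hmP : m ≤ bperiod hD h₀)
    {x : Site 2} {k : Fin 4} (h : ∃ t < m, D.bwalk d₀ (i + t) = (x, k)) :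
    (bloop i m hm hcl).W (toZ2 (faceAt x k)) = (bloop i m hm hcl).W (toZ2 (faceAt x (k + 3))) + 1 := by
  set c := bloop i m hm hcl with hc
  have hout : D.IsOutEdge x k := by
    obtain ⟨t, -, ht⟩ := h
    have := isOutEdge_bwalk h₀ (i + t)
    rwa [ht] at this
  have hf := cnt_bloop_of_exists (hm := hm) (hcl := hcl) hD h₀ hmP h
  have hr := cnt_bloop_reverse (i := i) (m := m) (hm := hm) (hcl := hcl) h₀ hout
  rw [← hc] at hf hr
  obtain rfl | rfl | rfl | rfl := fin4_cases k
  · -- east dart: left face `(a, b)` above, right face `(a, b - 1)` below the edge `(a,b)-(a+1,b)`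
    rw [toZ2_add_cornerUnit_zero, toZ2_mk] at hf hr
    rw [show (0 : Fin 4) + 3 = 3 from rfl, toZ2_faceAt_zero, toZ2_faceAt_three]
    have hj := c.W_succ_snd (x 0) (x 1 - 1)
    rw [sub_add_cancel, c.cH_eq_cnt, hf, hr] at hj
    linarith
  · -- north dart: left face `(a - 1, b)`, right face `(a, b)`
    rw [toZ2_add_cornerUnit_one, toZ2_mk] at hf hr
    rw [show (1 : Fin 4) + 3 = 0 from rfl, toZ2_faceAt_one, toZ2_faceAt_zero]
    have hj := c.W_succ_fst (x 0 - 1) (x 1)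
    rw [sub_add_cancel, c.cV_eq_cnt, hf, hr] at hj
    linarith
  · -- west dart: left face `(a - 1, b - 1)`, right face `(a - 1, b)`
    rw [toZ2_add_cornerUnit_two, toZ2_mk] at hf hr
    rw [show (2 : Fin 4) + 3 = 1 from rfl, toZ2_faceAt_two, toZ2_faceAt_one]
    have hj := c.W_succ_snd (x 0 - 1) (x 1 - 1)
    rw [sub_add_cancel, c.cH_eq_cnt, sub_add_cancel, hf, hr] at hj
    linarith
  · -- south dart: left face `(a, b - 1)`, right face `(a - 1, b - 1)`
    rw [toZ2_add_cornerUnit_three, toZ2_mk] at hf hr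
    rw [show (3 : Fin 4) + 3 = 2 from rfl, toZ2_faceAt_three, toZ2_faceAt_two]
    have hj := c.W_succ_fst (x 0 - 1) (x 1 - 1)
    rw [sub_add_cancel, c.cV_eq_cnt, sub_add_cancel, hf, hr] at hj
    linarith

/-- **No jump across an edge avoided by the piece** (in both directions): the two faces of the
edge at `x` in direction `k` have the same winding number. [folklore] -/
theorem W_bloop_eq_of_forall_ne {x : Site 2} {k : Fin 4} (h1 : ∀ t < m, D.bwalk d₀ (i + t) ≠ (x, k))
    (h2 : ∀ t < m, D.bwalk d₀ (i + t) ≠ (x + cornerUnit k, k + 2)) :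
    (bloop i m hm hcl).W (toZ2 (faceAt x k)) = (bloop i m hm hcl).W (toZ2 (faceAt x (k + 3))) := by
  set c := bloop i m hm hcl with hc
  have hf := cnt_bloop_of_forall_ne (hm := hm) (hcl := hcl) h1
  have hr : c.cnt (toZ2 (x + cornerUnit k)) (toZ2 x) = 0 := by
    have := cnt_bloop_of_forall_ne (hm := hm) (hcl := hcl) h2
    rwa [add_cornerUnit_add_cornerUnit_add_two] at this
  rw [← hc] at hf
  obtain rfl | rfl | rfl | rfl := fin4_cases k
  · rw [toZ2_add_cornerUnit_zero, toZ2_mk] at hf hr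
    rw [show (0 : Fin 4) + 3 = 3 from rfl, toZ2_faceAt_zero, toZ2_faceAt_three]
    have hj := c.W_succ_snd (x 0) (x 1 - 1)
    rw [sub_add_cancel, c.cH_eq_cnt, hf, hr] at hj
    linarith
  · rw [toZ2_add_cornerUnit_one, toZ2_mk] at hf hr
    rw [show (1 : Fin 4) + 3 = 0 from rfl, toZ2_faceAt_one, toZ2_faceAt_zero]
    have hj := c.W_succ_fst (x 0 - 1) (x 1)
    rw [sub_add_cancel, c.cV_eq_cnt, hf, hr] at hj
    linarith
  · rw [toZ2_add_cornerUnit_two, toZ2_mk] at hf hr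
    rw [show (2 : Fin 4) + 3 = 1 from rfl, toZ2_faceAt_two, toZ2_faceAt_one]
    have hj := c.W_succ_snd (x 0 - 1) (x 1 - 1)
    rw [sub_add_cancel, c.cH_eq_cnt, sub_add_cancel, hf, hr] at hj
    linarith
  · rw [toZ2_add_cornerUnit_three, toZ2_mk] at hf hr
    rw [show (3 : Fin 4) + 3 = 2 from rfl, toZ2_faceAt_three, toZ2_faceAt_two]
    have hj := c.W_succ_fst (x 0 - 1) (x 1 - 1)
    rw [sub_add_cancel, c.cV_eq_cnt, sub_add_cancel, hf, hr] at hj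
    linarith

end DiscreteDobrushin


/-! ### Coordinates on unit lattice segments -/

/-- A point of the unit segment between lattice neighbours has the common integer coordinate of
the endpoints and its other coordinate between theirs. [folklore] -/
theorem coord_of_mem_segment_latC {P Q : ℤ × ℤ} (hPQ : RectLoop.Adj P Q) {z : ℂ}
    (hz : z ∈ segment ℝ (latC P) (latC Q)) :
    (z.im = P.2 ∧ z.im = Q.2 ∧ min (P.1 : ℝ) Q.1 ≤ z.re ∧ z.re ≤ max (P.1 : ℝ) Q.1) ∨
      (z.re = P.1 ∧ z.re = Q.1 ∧ min (P.2 : ℝ) Q.2 ≤ z.im ∧ z.im ≤ max (P.2 : ℝ) Q.2) := by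
  obtain ⟨a, b, ha, hb, hab, rfl⟩ := hz
  obtain rfl : a = 1 - b := eq_sub_of_add_eq hab
  simp only [Complex.add_re, Complex.smul_re, latC_re, smul_eq_mul, Complex.add_im,
    Complex.smul_im, latC_im]
  rcases (adj_iff P Q).1 hPQ with ⟨h1, h2⟩ | ⟨h1, h2⟩ | ⟨h1, h2⟩ | ⟨h1, h2⟩
  · left
    rw [h1, h2]; push_cast
    refine ⟨by ring, by ring, ?_, ?_⟩
    · rw [min_eq_left (by linarith)]; nlinarith
    · rw [max_eq_right (by linarith)]; nlinarith
  · right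
    rw [h1, h2]; push_cast
    refine ⟨by ring, by ring, ?_, ?_⟩
    · rw [min_eq_left (by linarith)]; nlinarith
    · rw [max_eq_right (by linarith)]; nlinarith
  · left
    rw [h1, h2]; push_cast
    refine ⟨by ring, by ring, ?_, ?_⟩
    · rw [min_eq_right (by linarith)]; nlinarith
    · rw [max_eq_left (by linarith)]; nlinarith
  · right
    rw [h1, h2]; push_cast
    refine ⟨by ring, by ring, ?_, ?_⟩
    · rw [min_eq_right (by linarith)]; nlinarith
    · rw [max_eq_left (by linarith)]; nlinarith

/-! ### The trace of a lattice walk at mesh `δ` -/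

namespace ClosedWalk

variable {n : ℕ} (c : ClosedWalk n)

/-- The trace of the walk **at mesh `δ`**: the union of the segments between consecutive mesh
points `δ · v j`. [folklore] -/
def strace (δ : ℝ) : Set ℂ := (fun z : ℂ => (δ : ℂ) * z) '' c.trace

/-- The scaled trace is compact. [folklore] -/
theorem isCompact_strace (δ : ℝ) : IsCompact (c.strace δ) :=
  c.isCompact_trace.image (continuous_const.mul continuous_id)

/-- Scaling a unit lattice segment gives the segment between the mesh points. [folklore] -/
theorem image_mul_segment_latC (δ : ℝ) (P Q : ℤ × ℤ) :
    (fun z : ℂ => (δ : ℂ) * z) '' segment ℝ (latC P) (latC Q) =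
      segment ℝ ((δ : ℂ) * latC P) ((δ : ℂ) * latC Q) := by
  ext z
  constructor
  · rintro ⟨w, hw, rfl⟩
    rw [segment_eq_image_lineMap] at hw ⊢
    obtain ⟨θ, hθ, rfl⟩ := hw
    refine ⟨θ, hθ, ?_⟩
    simp only [AffineMap.lineMap_apply_module', Complex.real_smul]
    ring
  · intro hz
    rw [segment_eq_image_lineMap] at hz
    obtain ⟨θ, hθ, rfl⟩ := hz
    refine ⟨AffineMap.lineMap (latC P) (latC Q) θ, ?_, ?_⟩
    · rw [segment_eq_image_lineMap]; exact ⟨θ, hθ, rfl⟩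
    · simp only [AffineMap.lineMap_apply_module', Complex.real_smul]
      ring

/-- Membership in the scaled trace: on a scaled step segment. [folklore] -/
theorem mem_strace_iff {δ : ℝ} {z : ℂ} : z ∈ c.strace δ ↔
    ∃ j < n, z ∈ segment ℝ ((δ : ℂ) * latC (c.v j)) ((δ : ℂ) * latC (c.v (j + 1))) := by
  constructor
  · rintro ⟨w, hw, rfl⟩
    obtain ⟨j, hj, hjw⟩ := c.mem_trace_iff.1 hw
    refine ⟨j, hj, ?_⟩
    rw [← image_mul_segment_latC]
    exact ⟨w, hjw, rfl⟩
  · rintro ⟨j, hj, hz⟩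
    rw [← image_mul_segment_latC] at hz
    obtain ⟨w, hw, rfl⟩ := hz
    exact ⟨w, c.segment_subset_trace hj hw, rfl⟩

/-- The centre of the cell `f` at mesh `δ` is the scaled face centre. [folklore] -/
theorem cellCenter_eq_mul_faceCtr (δ : ℝ) (f : ℤ × ℤ) :
    cellCenter δ f.1 f.2 = (δ : ℂ) * faceCtr f := by
  apply Complex.ext <;> simp [cellCenter, faceCtr]

/-- Face centres are off the trace (they have no integer coordinate). [folklore] -/
theorem faceCtr_not_mem_trace (f : ℤ × ℤ) : faceCtr f ∉ c.trace := by
  intro h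
  obtain ⟨j, -, hj⟩ := c.mem_trace_iff.1 h
  have key : ∀ (k l : ℤ), (k : ℝ) + 1 / 2 ≠ l := by
    intro k l h
    have h2 : (2 * k + 1 : ℤ) = 2 * l := by exact_mod_cast (by linarith : (2 * k + 1 : ℝ) = 2 * l)
    omega
  rcases coord_of_mem_segment_latC (c.adj j) hj with ⟨h1, -, -, -⟩ | ⟨h1, -, -, -⟩
  · exact key f.2 _ (by simpa using h1)
  · exact key f.1 _ (by simpa using h1)

/-- **Far from the walk the winding number of the face containing a point vanishes.**
[folklore] -/
theorem exists_W_flFace_eq_zero (hn : 0 < n) : ∃ R : ℝ, ∀ w : ℂ, R < ‖w‖ → c.W (flFace w) = 0 := by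
  obtain ⟨M, hM⟩ := c.isCompact_trace.isBounded.exists_norm_le
  have hv1 : ∀ j, |((c.v j).1 : ℝ)| ≤ M := fun j =>
    (abs_re_le_norm (latC (c.v j))).trans (hM _ (c.latC_v_mem_trace hn j))
  have hv2 : ∀ j, |((c.v j).2 : ℝ)| ≤ M := fun j =>
    (abs_im_le_norm (latC (c.v j))).trans (hM _ (c.latC_v_mem_trace hn j))
  have hX : ∀ j, -⌈M⌉ ≤ (c.v j).1 ∧ (c.v j).1 ≤ ⌈M⌉ := fun j => by
    have h := abs_le.1 (hv1 j)
    have hc := Int.le_ceil M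
    constructor
    · exact_mod_cast (show (-⌈M⌉ : ℝ) ≤ (c.v j).1 by linarith)
    · exact_mod_cast (show ((c.v j).1 : ℝ) ≤ ⌈M⌉ by linarith)
  have hY : ∀ j, -⌈M⌉ ≤ (c.v j).2 ∧ (c.v j).2 ≤ ⌈M⌉ := fun j => by
    have h := abs_le.1 (hv2 j)
    have hc := Int.le_ceil M
    constructor
    · exact_mod_cast (show (-⌈M⌉ : ℝ) ≤ (c.v j).2 by linarith)
    · exact_mod_cast (show ((c.v j).2 : ℝ) ≤ ⌈M⌉ by linarith)
  refine ⟨2 * (M + 2), fun w hw => c.W_eq_zero_of_notMem_box hX hY ?_⟩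
  have hc1 := Int.le_ceil M
  have hc2 := Int.ceil_lt_add_one M
  have hsum : 2 * (M + 2) < |w.re| + |w.im| := lt_of_lt_of_le hw (Complex.norm_le_abs_re_add_abs_im w)
  simp only [flFace, Finset.mem_product, Finset.mem_Ico, not_and_or, not_le, not_lt]
  have hfr1 : ((⌊w.re⌋ : ℤ) : ℝ) ≤ w.re := Int.floor_le _
  have hfr2 : w.re < (⌊w.re⌋ : ℤ) + 1 := Int.lt_floor_add_one _
  have hfi1 : ((⌊w.im⌋ : ℤ) : ℝ) ≤ w.im := Int.floor_le _
  have hfi2 : w.im < (⌊w.im⌋ : ℤ) + 1 := Int.lt_floor_add_one _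
  by_cases hre : M + 2 < |w.re|
  · left
    rcases le_or_gt 0 w.re with h0 | h0
    · rw [abs_of_nonneg h0] at hre
      right
      exact_mod_cast (show ((⌈M⌉ : ℤ) : ℝ) ≤ ⌊w.re⌋ by linarith)
    · rw [abs_of_neg h0] at hre
      left
      exact_mod_cast (show ((⌊w.re⌋ : ℤ) : ℝ) < -⌈M⌉ by linarith)
  · right
    have him : M + 2 < |w.im| := by rw [not_lt] at hre; linarith
    rcases le_or_gt 0 w.im with h0 | h0
    · rw [abs_of_nonneg h0] at him
      right
      exact_mod_cast (show ((⌈M⌉ : ℤ) : ℝ) ≤ ⌊w.im⌋ by linarith)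
    · rw [abs_of_neg h0] at him
      left
      exact_mod_cast (show ((⌊w.im⌋ : ℤ) : ℝ) < -⌈M⌉ by linarith)

/-- **A face whose centre is joined to infinity off the scaled trace has winding number zero**
(`δ > 0`): the connected component of the centre in the complement of the trace is open, hence
path-connected, and `W ∘ flFace` is constant along paths off the trace and vanishes far away
(`LatticeWalkTrace`). [folklore] -/
theorem W_eq_zero_of_joined_far (hn : 0 < n) {δ : ℝ} (hδ : 0 < δ) {f : ℤ × ℤ}
    (hfar : ∀ R : ℝ, ∃ w ∈ connectedComponentIn (c.strace δ)ᶜ (cellCenter δ f.1 f.2), R < ‖w‖) :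
    c.W f = 0 := by
  obtain ⟨R, hR⟩ := c.exists_W_flFace_eq_zero hn
  obtain ⟨w, hw, hwR⟩ := hfar (δ * |R|)
  have hδ0 : (δ : ℂ) ≠ 0 := by exact_mod_cast hδ.ne'
  set z₀ := cellCenter δ f.1 f.2 with hz₀
  have hz₀t : z₀ ∈ (c.strace δ)ᶜ := by
    rintro ⟨u, hu, hu'⟩
    rw [hz₀, cellCenter_eq_mul_faceCtr] at hu'
    exact c.faceCtr_not_mem_trace f (mul_left_cancel₀ hδ0 hu' ▸ hu)
  have hO : IsOpen (c.strace δ)ᶜ := (c.isCompact_strace δ).isClosed.isOpen_compl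
  have hU : IsOpen (connectedComponentIn (c.strace δ)ᶜ z₀) := hO.connectedComponentIn
  have hconn : IsConnected (connectedComponentIn (c.strace δ)ᶜ z₀) :=
    isConnected_connectedComponentIn_iff.2 hz₀t
  have hj : JoinedIn (c.strace δ)ᶜ z₀ w :=
    (((hU.isConnected_iff_isPathConnected).1 hconn).joinedIn _ (mem_connectedComponentIn hz₀t)
      _ hw).mono (connectedComponentIn_subset _ _)
  -- descale by `δ⁻¹`
  have hj' : JoinedIn c.traceᶜ (faceCtr f) ((δ : ℂ)⁻¹ * w) := by
    have h := hj.map (f := fun z : ℂ => (δ : ℂ)⁻¹ * z) (continuous_const.mul continuous_id)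
    have h0 : (δ : ℂ)⁻¹ * z₀ = faceCtr f := by
      rw [hz₀, cellCenter_eq_mul_faceCtr, ← mul_assoc, inv_mul_cancel₀ hδ0, one_mul]
    simp only [h0] at h
    refine h.mono ?_
    rintro _ ⟨u, hu, rfl⟩ hut
    refine hu ⟨(δ : ℂ)⁻¹ * u, hut, ?_⟩
    simp only [← mul_assoc, mul_inv_cancel₀ hδ0, one_mul]
  rw [← flFace_faceCtr f, c.W_flFace_eq_of_joinedIn hn hj']
  refine hR _ ?_
  rw [norm_mul, norm_inv, Complex.norm_real, Real.norm_of_nonneg hδ.le, inv_mul_eq_div,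
    lt_div_iff₀ hδ]
  calc R * δ ≤ |R| * δ := mul_le_mul_of_nonneg_right (le_abs_self R) hδ.le
    _ = δ * |R| := mul_comm _ _
    _ < ‖w‖ := hwR

end ClosedWalk


/-! ### Exit witnesses of non-inner faces and their vanishing winding numbers -/

namespace DiscreteDobrushin

variable {D : DiscreteDobrushin} {d₀ : Site 2 × Fin 4}

/-- The `Bool`-indexed corners of `MeshColumns` are corners in the sense of `IsCorner`.
[folklore] -/
theorem isCorner_corner (F : Site 2) (a b : Bool) : IsCorner (Mesh.corner (F 0) (F 1) a b) F := by
  intro i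
  fin_cases i <;> cases a <;> cases b <;> simp [Mesh.corner]

/-- **Exit witness of a non-inner face.** If the face `F` is not inner but has a corner in
`Ω_δ`, then either some side of `F` leaves `closure Ω`, or some corner of `F` is not a mesh
vertex (its mesh point is off `Ω`). Indeed, otherwise all sides are mesh edges between mesh
vertices, all corners are joined through them to the corner in `Ω_δ` (a union of components of
the mesh graph), and `F` would be inner. [cite: Smirnov2001, §2] -/
theorem exists_witness_of_not_isInnerFace {F : Site 2} (hF : ¬ D.IsInnerFace F)
    {x₀ : Site 2} (hx₀ : IsCorner x₀ F) (hx₀D : x₀ ∈ meshDomain D.Ω D.δ) :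
    (∃ v w, IsCorner v F ∧ IsCorner w F ∧ (zdGraph 2).Adj v w ∧
        ¬ segment ℝ (meshPoint D.δ v) (meshPoint D.δ w) ⊆ closure D.Ω) ∨
      ∃ u, IsCorner u F ∧ u ∉ meshVertices D.Ω D.δ := by
  by_contra h
  simp only [not_or, not_exists, not_and, not_not] at h
  obtain ⟨hside, hvert⟩ := h
  apply hF
  set k := F 0
  set j := F 1
  have hV : ∀ a b, Mesh.corner k j a b ∈ meshVertices D.Ω D.δ := fun a b => hvert _ (isCorner_corner F a b)
  have hA : ∀ a b a' b', (zdGraph 2).Adj (Mesh.corner k j a b) (Mesh.corner k j a' b') →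
      (meshVertexGraph D.Ω D.δ).Adj ⟨_, hV a b⟩ ⟨_, hV a' b'⟩ := by
    intro a b a' b' hadj
    rw [Mesh.meshVertexGraph_adj_iff]
    exact meshGraph_adj_iff.2 ⟨hadj, hside _ _ (isCorner_corner F a b) (isCorner_corner F a' b') hadj⟩
  -- every corner is reachable from every other corner inside the mesh graph on mesh vertices
  have hreach : ∀ a b a' b', (meshVertexGraph D.Ω D.δ).Reachable ⟨_, hV a b⟩ ⟨_, hV a' b'⟩ := by
    have hh : ∀ b a a', (meshVertexGraph D.Ω D.δ).Reachable ⟨_, hV a b⟩ ⟨_, hV a' b⟩ := by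
      intro b a a'
      cases a <;> cases a'
      · rfl
      · exact (hA _ _ _ _ (Mesh.zdGraph_adj_corner_horizontal k j b)).reachable
      · exact (hA _ _ _ _ (Mesh.zdGraph_adj_corner_horizontal k j b)).reachable.symm
      · rfl
    have hv : ∀ a b b', (meshVertexGraph D.Ω D.δ).Reachable ⟨_, hV a b⟩ ⟨_, hV a b'⟩ := by
      intro a b b'
      cases b <;> cases b'
      · rfl
      · exact (hA _ _ _ _ (Mesh.zdGraph_adj_corner_vertical k j a)).reachable
      · exact (hA _ _ _ _ (Mesh.zdGraph_adj_corner_vertical k j a)).reachable.symm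
      · rfl
    intro a b a' b'
    exact (hh b a a').trans (hv a' b b')
  obtain ⟨a₀, b₀, hx₀eq⟩ := exists_corner_eq_of_isCorner hx₀
  have hmem : ∀ a b, Mesh.corner k j a b ∈ meshDomain D.Ω D.δ := by
    intro a b
    have hx₀V : x₀ ∈ meshVertices D.Ω D.δ := by rw [hx₀eq]; exact hV a₀ b₀
    refine mem_meshDomain_of_reachable (E := D) hx₀D (h₁ := hx₀V) (h₂ := hV a b) ?_
    have : (⟨x₀, hx₀V⟩ : meshVertices D.Ω D.δ) = ⟨_, hV a₀ b₀⟩ := Subtype.ext hx₀eq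
    rw [this]
    exact hreach a₀ b₀ a b
  intro v w hv hw hadj
  obtain ⟨a, b, rfl⟩ := exists_corner_eq_of_isCorner hv
  obtain ⟨a', b', rfl⟩ := exists_corner_eq_of_isCorner hw
  exact discreteDomainGraph_adj_iff.2 ⟨meshGraph_adj_iff.2 ⟨hadj, hside _ _ hv hw hadj⟩, hmem a b, hmem a' b'⟩

/-- The vertices of the boundary walk lie in `Ω_δ` (they are corners of inner faces).
[cite: Smirnov2001, §2] -/
theorem bwalk_fst_mem_meshDomain (h₀ : D.IsOutEdge d₀.1 d₀.2) (t : ℕ) :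
    (D.bwalk d₀ t).1 ∈ meshDomain D.Ω D.δ :=
  (discreteDomainGraph_adj_iff.1 (adj_of_isInnerFace_faceAt (isOutEdge_bwalk h₀ t).1 (Or.inl rfl))).2.1

/-- The mesh point of a site is the scaled lattice point. [folklore] -/
theorem meshPoint_eq_mul_latC (δ : ℝ) (x : Site 2) : meshPoint δ x = (δ : ℂ) * latC (toZ2 x) := rfl

variable {i m : ℕ} {hm : 0 < m} {hcl : (D.bwalk d₀ (i + m)).1 = (D.bwalk d₀ i).1}

/-- **The scaled polygon of a piece of the boundary walk runs along sides of inner faces, hence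
inside `closure Ω`.** [cite: Smirnov2001, §2] -/
theorem strace_bloop_subset (h₀ : D.IsOutEdge d₀.1 d₀.2) :
    (bloop i m hm hcl).strace D.δ ⊆ closure D.Ω := by
  intro z hz
  obtain ⟨t, -, ht⟩ := (bloop i m hm hcl).mem_strace_iff.1 hz
  rw [bloop_v, bloop_v_succ, ← meshPoint_eq_mul_latC, ← meshPoint_eq_mul_latC] at ht
  set p := D.bwalk d₀ (i + t % m)
  have hout := isOutEdge_bwalk h₀ (i + t % m)
  exact segment_subset_closure_of_isInnerFace (E := D) hout.1 (isCorner_faceAt p.1 p.2)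
    ((isCorner_add_faceAt_iff p.1 p.2 p.2).2 (Or.inl rfl)) (cSrc_mem_edgeSet p) ht

/-- A point of the scaled polygon has a coordinate on the scaled lattice: it lies on a scaled
unit segment, horizontal or vertical, between two consecutive vertices. [folklore] -/
theorem exists_coord_of_mem_strace {z : ℂ} (hz : z ∈ (bloop i m hm hcl).strace D.δ) :
    ∃ t < m, ∃ P Q : ℤ × ℤ, P = toZ2 (D.bwalk d₀ (i + t)).1 ∧
      Q = toZ2 ((D.bwalk d₀ (i + t)).1 + cornerUnit (D.bwalk d₀ (i + t)).2) ∧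
      ∃ z' ∈ segment ℝ (latC P) (latC Q), z = (D.δ : ℂ) * z' ∧
      ((z'.im = P.2 ∧ z'.im = Q.2 ∧ min (P.1 : ℝ) Q.1 ≤ z'.re ∧ z'.re ≤ max (P.1 : ℝ) Q.1) ∨
       (z'.re = P.1 ∧ z'.re = Q.1 ∧ min (P.2 : ℝ) Q.2 ≤ z'.im ∧ z'.im ≤ max (P.2 : ℝ) Q.2)) := by
  obtain ⟨z', hz', rfl⟩ := hz
  obtain ⟨t, ht, htz⟩ := (bloop i m hm hcl).mem_trace_iff.1 hz'
  refine ⟨t, ht, _, _, rfl, rfl, z', ?_, rfl, ?_⟩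
  · rwa [bloop_v_of_lt ht, bloop_v_succ, Nat.mod_eq_of_lt ht] at htz
  · have hadj : RectLoop.Adj (toZ2 (D.bwalk d₀ (i + t)).1)
        (toZ2 ((D.bwalk d₀ (i + t)).1 + cornerUnit (D.bwalk d₀ (i + t)).2)) :=
      ⟨_, toZ2_add_cornerUnit _ _⟩
    rw [bloop_v_of_lt ht, bloop_v_succ, Nat.mod_eq_of_lt ht] at htz
    exact coord_of_mem_segment_latC hadj htz

/-- **Open cells miss the scaled polygon.** [folklore] -/
theorem disjoint_cell_strace (hδ : 0 < D.δ) (k j : ℤ) :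
    Disjoint (Mesh.cell D.δ k j) ((bloop i m hm hcl).strace D.δ) := by
  rw [Set.disjoint_left]
  intro z hz hz'
  obtain ⟨t, -, P, Q, -, -, z', -, rfl, hcoord⟩ := exists_coord_of_mem_strace hz'
  rw [Mesh.mem_cell_iff] at hz
  simp only [Complex.mul_re, Complex.mul_im, Complex.ofReal_re, Complex.ofReal_im, zero_mul,
    sub_zero, add_zero] at hz
  obtain ⟨⟨h1, h2⟩, h3, h4⟩ := hz
  rcases hcoord with ⟨hi, -, -, -⟩ | ⟨hr, -, -, -⟩
  · rw [hi] at h3 h4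
    have h3' : (j : ℝ) < P.2 := by
      have := lt_of_mul_lt_mul_left h3 hδ.le; exact_mod_cast this
    have h4' : (P.2 : ℝ) < j + 1 := by
      have := lt_of_mul_lt_mul_left h4 hδ.le; exact_mod_cast this
    have : (j : ℤ) < P.2 := by exact_mod_cast h3'
    have : P.2 < j + 1 := by exact_mod_cast h4'
    omega
  · rw [hr] at h1 h2
    have h1' : (k : ℝ) < P.1 := by
      have := lt_of_mul_lt_mul_left h1 hδ.le; exact_mod_cast this
    have h2' : (P.1 : ℝ) < k + 1 := by
      have := lt_of_mul_lt_mul_left h2 hδ.le; exact_mod_cast this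
    have : (k : ℤ) < P.1 := by exact_mod_cast h1'
    have : P.1 < k + 1 := by exact_mod_cast h2'
    omega

/-- An integer between two consecutive integers (in either order) is one of them. [folklore] -/
theorem int_eq_or_eq_of_mem {a p q : ℤ} (hpq : q = p + 1 ∨ q = p - 1) (h1 : min (p : ℝ) q ≤ a)
    (h2 : (a : ℝ) ≤ max (p : ℝ) q) : a = p ∨ a = q := by
  rcases hpq with rfl | rfl
  · push_cast at h1 h2
    rw [min_eq_left (by linarith)] at h1
    rw [max_eq_right (by linarith)] at h2
    have h1' : p ≤ a := by exact_mod_cast h1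
    have h2' : a ≤ p + 1 := by exact_mod_cast h2
    omega
  · push_cast at h1 h2
    rw [min_eq_right (by linarith)] at h1
    rw [max_eq_left (by linarith)] at h2
    have h1' : p - 1 ≤ a := by exact_mod_cast h1
    have h2' : a ≤ p := by exact_mod_cast h2
    omega

/-- **A lattice point on the scaled polygon is a vertex of the walk**, hence lies in `Ω_δ`.
[folklore] -/
theorem mem_meshDomain_of_meshPoint_mem_strace (hδ : 0 < D.δ) (h₀ : D.IsOutEdge d₀.1 d₀.2)
    {u : Site 2} (hu : meshPoint D.δ u ∈ (bloop i m hm hcl).strace D.δ) :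
    u ∈ meshDomain D.Ω D.δ := by
  obtain ⟨t, -, P, Q, hP, hQ, z', -, hz, hcoord⟩ := exists_coord_of_mem_strace hu
  have hδ0 : (D.δ : ℂ) ≠ 0 := by exact_mod_cast hδ.ne'
  rw [meshPoint_eq_mul_latC] at hz
  have hz' : latC (toZ2 u) = z' := mul_left_cancel₀ hδ0 hz
  rw [← hz'] at hcoord
  simp only [latC_re, latC_im, toZ2_mk] at hcoord
  have hPQ : RectLoop.Adj P Q := by rw [hP, hQ]; exact ⟨_, toZ2_add_cornerUnit _ _⟩
  -- the integer point `u` on the unit segment `PQ` is `P` or `Q`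
  have key : toZ2 u = P ∨ toZ2 u = Q := by
    simp only [toZ2_mk, Prod.ext_iff]
    rcases hcoord with ⟨hi, hi', hlo, hhi⟩ | ⟨hr, hr', hlo, hhi⟩
    · have h1 : u 1 = P.2 := by exact_mod_cast hi
      have h1' : u 1 = Q.2 := by exact_mod_cast hi'
      have hq : Q.1 = P.1 + 1 ∨ Q.1 = P.1 - 1 := by
        rcases (adj_iff P Q).1 hPQ with ⟨hq1, -⟩ | ⟨-, hq2⟩ | ⟨hq1, -⟩ | ⟨-, hq2⟩
        · exact Or.inl hq1
        · exfalso; omega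
        · exact Or.inr hq1
        · exfalso; omega
      rcases int_eq_or_eq_of_mem hq hlo hhi with h0 | h0
      · exact Or.inl ⟨h0, h1⟩
      · exact Or.inr ⟨h0, h1'⟩
    · have h0 : u 0 = P.1 := by exact_mod_cast hr
      have h0' : u 0 = Q.1 := by exact_mod_cast hr'
      have hq : Q.2 = P.2 + 1 ∨ Q.2 = P.2 - 1 := by
        rcases (adj_iff P Q).1 hPQ with ⟨hq1, -⟩ | ⟨-, hq2⟩ | ⟨hq1, -⟩ | ⟨-, hq2⟩
        · exfalso; omega
        · exact Or.inl hq2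
        · exfalso; omega
        · exact Or.inr hq2
      rcases int_eq_or_eq_of_mem hq hlo hhi with h1 | h1
      · exact Or.inl ⟨h0, h1⟩
      · exact Or.inr ⟨h0', h1⟩
  rcases key with h | h
  · have : u = (D.bwalk d₀ (i + t)).1 := toZ2_injective (h.trans hP)
    rw [this]; exact bwalk_fst_mem_meshDomain h₀ _
  · have : u = (D.bwalk d₀ (i + t)).1 + cornerUnit (D.bwalk d₀ (i + t)).2 :=
      toZ2_injective (h.trans hQ)
    rw [this, ← bwalk_fst_succ]; exact bwalk_fst_mem_meshDomain h₀ _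

end DiscreteDobrushin


/-! ### Non-inner faces next to `Ω_δ` have winding number zero (regular exterior) -/

namespace DiscreteDobrushin

variable {D : DiscreteDobrushin} {d₀ : Site 2 × Fin 4}
variable {i m : ℕ} {hm : 0 < m} {hcl : (D.bwalk d₀ (i + m)).1 = (D.bwalk d₀ i).1}

/-- The centre of the cell of a face is joined, inside the complement of the scaled polygon of a
piece of the boundary walk, to every point of the closed cell off the polygon (along the segment,
whose open part lies in the open cell). [folklore] -/
theorem mem_connectedComponentIn_of_mem_closure_cell (hδ : 0 < D.δ) {F : Site 2} {p : ℂ}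
    (hp : p ∈ closure (Mesh.cell D.δ (F 0) (F 1))) (hpr : p ∉ (bloop i m hm hcl).strace D.δ) :
    p ∈ connectedComponentIn ((bloop i m hm hcl).strace D.δ)ᶜ (Mesh.cellCenter D.δ (F 0) (F 1)) := by
  set z₀ := Mesh.cellCenter D.δ (F 0) (F 1)
  have hz₀ : z₀ ∈ Mesh.cell D.δ (F 0) (F 1) := Mesh.cellCenter_mem_cell hδ _ _
  have hdis := disjoint_cell_strace (i := i) (m := m) (hm := hm) (hcl := hcl) hδ (F 0) (F 1)
  have hsub : segment ℝ z₀ p ⊆ ((bloop i m hm hcl).strace D.δ)ᶜ := by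
    rw [← insert_endpoints_openSegment]
    intro z hz
    rcases hz with rfl | rfl | hz
    · exact Set.disjoint_left.1 hdis hz₀
    · exact hpr
    · exact Set.disjoint_left.1 hdis (Mesh.openSegment_subset_cell_of_mem_closure _ _ hz₀ hp hz)
  exact (convex_segment z₀ p).isPreconnected.subset_connectedComponentIn (left_mem_segment ℝ z₀ p) hsub
    (right_mem_segment ℝ z₀ p)

/-- **An exterior point joined to the centre of a non-inner face next to `Ω_δ`.** For open `Ω`
whose frontier lies in the closure of the exterior `(closure Ω)ᶜ`: if the face `F` is not inner
but has a corner in `Ω_δ`, some point of the exterior is joined to the centre of the cell of `F`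
inside the complement of the scaled polygon of any piece of the boundary walk (through the exit
witness of `exists_witness_of_not_isInnerFace`). [folklore] -/
theorem exists_exterior_mem_connectedComponentIn (hδ : 0 < D.δ) (h₀ : D.IsOutEdge d₀.1 d₀.2)
    (hΩo : IsOpen D.Ω) (hfr : frontier D.Ω ⊆ closure (closure D.Ω)ᶜ)
    {F : Site 2} (hF : ¬ D.IsInnerFace F) {x₀ : Site 2} (hx₀ : IsCorner x₀ F)
    (hx₀D : x₀ ∈ meshDomain D.Ω D.δ) :
    ∃ q ∈ (closure D.Ω)ᶜ,
      q ∈ connectedComponentIn ((bloop i m hm hcl).strace D.δ)ᶜ (Mesh.cellCenter D.δ (F 0) (F 1)) := by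
  have hrange := strace_bloop_subset (i := i) (m := m) (hm := hm) (hcl := hcl) h₀
  rcases exists_witness_of_not_isInnerFace hF hx₀ hx₀D with ⟨v, w, hv, hw, hvw, hseg⟩ | ⟨u, hu, huV⟩
  · -- a side of `F` leaves `closure Ω` at `p`
    obtain ⟨p, hp, hpΩ⟩ := Set.not_subset.1 hseg
    refine ⟨p, hpΩ, mem_connectedComponentIn_of_mem_closure_cell hδ ?_ fun h => hpΩ (hrange h)⟩
    exact segment_subset_closure_cell_of_isCorner hδ hv hw hp
  · -- a corner `u` of `F` off `Ω`: its mesh point is off the polygon, and near it lies an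
    -- exterior point
    have hup : meshPoint D.δ u ∉ (bloop i m hm hcl).strace D.δ := fun h =>
      huV (meshDomain_subset_meshVertices _ _ (mem_meshDomain_of_meshPoint_mem_strace hδ h₀ h))
    have hu1 := mem_connectedComponentIn_of_mem_closure_cell (i := i) (m := m) (hm := hm) (hcl := hcl)
      hδ (meshPoint_mem_closure_cell_of_isCorner hδ hu) hup
    -- a ball about the mesh point of `u` off the polygon
    have hopen : IsOpen ((bloop i m hm hcl).strace D.δ)ᶜ :=
      ((bloop i m hm hcl).isCompact_strace D.δ).isClosed.isOpen_compl
    obtain ⟨r, hr, hball⟩ := Metric.isOpen_iff.1 hopen _ hup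
    obtain ⟨q, hqb, hqE⟩ := Mesh.exists_mem_exterior_of_isOpen hΩo hfr Metric.isOpen_ball
      (Metric.mem_ball_self hr) huV
    refine ⟨q, hqE, ?_⟩
    rw [connectedComponentIn_eq hu1]
    exact (convex_ball _ _).isPreconnected.subset_connectedComponentIn (Metric.mem_ball_self hr) hball hqb

/-- **Non-inner faces next to `Ω_δ` have winding number zero** for every closed piece of the
boundary walk, provided `Ω` is open with a connected, unbounded exterior `(closure Ω)ᶜ` whose
closure contains `∂Ω` (all true for Jordan domains): the centre of the face is joined to the
exterior off the polygon (`exists_exterior_mem_connectedComponentIn`), the exterior misses the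
polygon (which runs along sides of inner faces, inside `closure Ω`) and reaches infinity.
[folklore] -/
theorem W_bloop_eq_zero_of_not_isInnerFace (hδ : 0 < D.δ) (h₀ : D.IsOutEdge d₀.1 d₀.2)
    (hΩo : IsOpen D.Ω) (hext : IsConnected (closure D.Ω)ᶜ) (hunb : ¬ Bornology.IsBounded (closure D.Ω)ᶜ)
    (hfr : frontier D.Ω ⊆ closure (closure D.Ω)ᶜ)
    {F : Site 2} (hF : ¬ D.IsInnerFace F) {x₀ : Site 2} (hx₀ : IsCorner x₀ F)
    (hx₀D : x₀ ∈ meshDomain D.Ω D.δ) : (bloop i m hm hcl).W (toZ2 F) = 0 := by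
  apply (bloop i m hm hcl).W_eq_zero_of_joined_far hm hδ
  intro R
  obtain ⟨q, hqE, hqC⟩ := exists_exterior_mem_connectedComponentIn (hm := hm) (hcl := hcl) hδ h₀ hΩo hfr
    hF hx₀ hx₀D
  -- a far point of the (unbounded) exterior
  obtain ⟨w, hwE, hwR⟩ : ∃ w ∈ (closure D.Ω)ᶜ, R < ‖w‖ := by
    by_contra! h
    exact hunb ((Metric.isBounded_closedBall (x := (0 : ℂ)) (r := R)).subset fun w hw => by
      simpa using h w hw)
  have hsub : (closure D.Ω)ᶜ ⊆ ((bloop i m hm hcl).strace D.δ)ᶜ :=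
    Set.compl_subset_compl.2 (strace_bloop_subset h₀)
  have hw : w ∈ connectedComponentIn ((bloop i m hm hcl).strace D.δ)ᶜ q :=
    connectedComponentIn_mono q hsub (hext.isPreconnected.subset_connectedComponentIn hqE subset_rfl hwE)
  refine ⟨w, ?_, hwR⟩
  simp only [toZ2_mk]
  rw [connectedComponentIn_eq hqC]
  exact hw

/-- In particular **the right faces of the darts of the piece have winding number zero** (they
are non-inner, with the dart's source in `Ω_δ`). [folklore] -/
theorem W_bloop_right_eq_zero (hδ : 0 < D.δ) (h₀ : D.IsOutEdge d₀.1 d₀.2)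
    (hΩo : IsOpen D.Ω) (hext : IsConnected (closure D.Ω)ᶜ) (hunb : ¬ Bornology.IsBounded (closure D.Ω)ᶜ)
    (hfr : frontier D.Ω ⊆ closure (closure D.Ω)ᶜ) (t : ℕ) :
    (bloop i m hm hcl).W (toZ2 (faceAt (D.bwalk d₀ t).1 ((D.bwalk d₀ t).2 + 3))) = 0 :=
  W_bloop_eq_zero_of_not_isInnerFace hδ h₀ hΩo hext hunb hfr (isOutEdge_bwalk h₀ t).2
    (isCorner_faceAt _ _) (bwalk_fst_mem_meshDomain h₀ t)

/-- … and **the left faces of the darts of the piece have winding number one**. [folklore] -/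
theorem W_bloop_left_eq_one (hD : D.IsZdAdmissible) (h₀ : D.IsOutEdge d₀.1 d₀.2) (hmP : m ≤ bperiod hD h₀)
    (hΩo : IsOpen D.Ω) (hext : IsConnected (closure D.Ω)ᶜ) (hunb : ¬ Bornology.IsBounded (closure D.Ω)ᶜ)
    (hfr : frontier D.Ω ⊆ closure (closure D.Ω)ᶜ) {t : ℕ} (ht : t < m) :
    (bloop i m hm hcl).W (toZ2 (faceAt (D.bwalk d₀ (i + t)).1 (D.bwalk d₀ (i + t)).2)) = 1 := by
  rw [W_bloop_left hD h₀ hmP ⟨t, ht, rfl⟩, W_bloop_right_eq_zero hD.delta_pos h₀ hΩo hext hunb hfr, zero_add]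

end DiscreteDobrushin


/-! ### The boundary cycle passes every vertex once -/

namespace DiscreteDobrushin

variable {D : DiscreteDobrushin} {d₀ : Site 2 × Fin 4}

/-- Two distinct elements of `Fin 4` differ by `1`, `2` or `3`. [folklore] -/
theorem fin4_eq_add_of_ne {k k' : Fin 4} (h : k' ≠ k) : k' = k + 1 ∨ k' = k + 2 ∨ k' = k + 3 := by
  revert k k'; decide

/-- The dart before position `s` of the walk is the predecessor of the dart at `s`, and sits at
position `s + P - 1`. [folklore] -/
theorem bwalk_add_bperiod_sub_one (hD : D.IsZdAdmissible) (h₀ : D.IsOutEdge d₀.1 d₀.2) (s : ℕ) :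
    D.bwalk d₀ (s + bperiod hD h₀ - 1) = D.bpred (D.bwalk d₀ s) := by
  have hP := bperiod_pos hD h₀
  have h1 : D.bsucc (D.bwalk d₀ (s + bperiod hD h₀ - 1)) = D.bwalk d₀ s := by
    rw [← bwalk_succ, show s + bperiod hD h₀ - 1 + 1 = s + bperiod hD h₀ by omega, bwalk_add_bperiod]
  rw [← h1, bpred_bsucc (isOutEdge_bwalk h₀ _)]

/-- Two darts of the walk sourced at the same vertex point in opposite directions, the two faces
between them on one side being inner and the two on the other side not (a pinch of the inner
faces). [folklore] -/
theorem snd_eq_add_two_of_fst_eq (h₀ : D.IsOutEdge d₀.1 d₀.2) {s t : ℕ}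
    (hv : (D.bwalk d₀ t).1 = (D.bwalk d₀ s).1) (hne : D.bwalk d₀ s ≠ D.bwalk d₀ t) :
    (D.bwalk d₀ t).2 = (D.bwalk d₀ s).2 + 2 := by
  have hs := isOutEdge_bwalk h₀ s
  have ht := isOutEdge_bwalk h₀ t
  rw [hv] at ht
  have hk : (D.bwalk d₀ t).2 ≠ (D.bwalk d₀ s).2 := fun h => hne (Prod.ext hv.symm h.symm)
  rcases fin4_eq_add_of_ne hk with h | h | h
  · exfalso; rw [h] at ht; exact ht.2 (by rw [fin4_add_one_add_three]; exact hs.1)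
  · exact h
  · exfalso; rw [h] at ht; exact hs.2 ht.1

/-- **The boundary cycle is vertex-simple** when `Ω` is open with a connected unbounded exterior
whose closure contains `∂Ω` (e.g. a Jordan domain). If the walk returned to a vertex `v` within a
period, leaving it first in direction `k` and later in direction `k + 2` (a pinch:
faces `k`, `k + 2` at `v` inner, faces `k + 1`, `k + 3` not), the closed sub-walk in between
would give the two non-inner faces at `v` winding numbers differing by one
(`W_bloop_left`, `W_bloop_eq_of_forall_ne`), whereas both vanish
(`W_bloop_eq_zero_of_not_isInnerFace`). [folklore] -/
theorem bwalk_fst_injOn (hD : D.IsZdAdmissible) (h₀ : D.IsOutEdge d₀.1 d₀.2)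
    (hΩo : IsOpen D.Ω) (hext : IsConnected (closure D.Ω)ᶜ) (hunb : ¬ Bornology.IsBounded (closure D.Ω)ᶜ)
    (hfr : frontier D.Ω ⊆ closure (closure D.Ω)ᶜ) {s t : ℕ} (hsP : s < bperiod hD h₀)
    (htP : t < bperiod hD h₀) (h : (D.bwalk d₀ s).1 = (D.bwalk d₀ t).1) : s = t := by
  by_contra hst
  wlog hlt : s < t generalizing s t
  · exact this htP hsP h.symm (Ne.symm hst) (lt_of_le_of_ne (not_lt.1 hlt) (Ne.symm hst))
  set P := bperiod hD h₀ with hPdef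
  have hδ := hD.delta_pos
  set v := (D.bwalk d₀ s).1 with hvdef
  set k := (D.bwalk d₀ s).2 with hkdef
  have hne : D.bwalk d₀ s ≠ D.bwalk d₀ t := fun h' => hst (bwalk_injOn hD h₀ hsP htP h')
  have hk' : (D.bwalk d₀ t).2 = k + 2 := snd_eq_add_two_of_fst_eq h₀ h.symm hne
  have hs_eq : D.bwalk d₀ s = (v, k) := rfl
  have ht_eq : D.bwalk d₀ t = (v, k + 2) := Prod.ext h.symm hk'
  have hOs := isOutEdge_bwalk h₀ s
  have hOt := isOutEdge_bwalk h₀ t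
  rw [ht_eq] at hOt
  -- faces `k`, `k+2` inner; `k+1`, `k+3` not
  have hI0 : D.IsInnerFace (faceAt v k) := hOs.1
  have hO3 : ¬ D.IsInnerFace (faceAt v (k + 3)) := hOs.2
  have hO1 : ¬ D.IsInnerFace (faceAt v (k + 1)) := by have := hOt.2; rwa [fin4_add_two_add_three] at this
  -- the closed sub-walk from `s` to `t`
  set m := t - s with hmdef
  have hm : 0 < m := by omega
  have hmP : m ≤ P := by omega
  have hcl : (D.bwalk d₀ (s + m)).1 = (D.bwalk d₀ s).1 := by
    rw [show s + m = t by omega]; exact h.symm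
  have hvD : v ∈ meshDomain D.Ω D.δ := bwalk_fst_mem_meshDomain h₀ s
  -- the two non-inner faces have winding number zero
  have hZ1 : (bloop s m hm hcl).W (toZ2 (faceAt v (k + 1))) = 0 :=
    W_bloop_eq_zero_of_not_isInnerFace hδ h₀ hΩo hext hunb hfr hO1 (isCorner_faceAt v _) hvD
  have hZ3 : (bloop s m hm hcl).W (toZ2 (faceAt v (k + 3))) = 0 :=
    W_bloop_eq_zero_of_not_isInnerFace hδ h₀ hΩo hext hunb hfr hO3 (isCorner_faceAt v _) hvD
  -- across the dart `(v, k)` of the sub-walk the winding number jumps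
  have hR1 : (bloop s m hm hcl).W (toZ2 (faceAt v k)) = (bloop s m hm hcl).W (toZ2 (faceAt v (k + 3))) + 1 :=
    W_bloop_left hD h₀ hmP ⟨0, hm, by rw [add_zero]⟩
  -- the edge in direction `k + 1` at `v` is avoided by the sub-walk
  have hR3 : (bloop s m hm hcl).W (toZ2 (faceAt v (k + 1))) = (bloop s m hm hcl).W (toZ2 (faceAt v k)) := by
    have := W_bloop_eq_of_forall_ne (i := s) (m := m) (hm := hm) (hcl := hcl) (x := v) (k := k + 1)
      ?_ ?_
    · rwa [fin4_add_one_add_three] at this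
    · intro t' _ heq
      have := isOutEdge_bwalk h₀ (s + t')
      rw [heq] at this
      exact hO1 this.1
    · intro t' ht' heq
      -- this dart is the predecessor of `(v, k)`, at position `s + P - 1`, not in the sub-walk
      have hpred : D.bpred (D.bwalk d₀ s) = (v + cornerUnit (k + 1), k + 1 + 2) := by
        rw [hs_eq]
        unfold bpred
        simp only
        rw [if_neg hO1, fin4_add_one_add_two]
      rw [← hpred, ← bwalk_add_bperiod_sub_one hD h₀ s, bwalk_eq_iff_mod_eq hD h₀] at heq
      rw [Nat.mod_eq_of_lt (by omega : s + t' < P)] at heq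
      rcases Nat.eq_zero_or_pos s with hs0 | hs0
      · rw [hs0, zero_add, zero_add, Nat.mod_eq_of_lt (by omega : P - 1 < P)] at heq
        omega
      · rw [show s + P - 1 = (s - 1) + P by omega, Nat.add_mod_right,
          Nat.mod_eq_of_lt (by omega : s - 1 < P)] at heq
        omega
  omega

end DiscreteDobrushin


/-! ### Half-open lattice edges meet only as they should -/

section HalfEdges

/-- `latC` is additive. [folklore] -/
theorem latC_add (p q : ℤ × ℤ) : latC (p + q) = latC p + latC q := by
  apply Complex.ext <;> simp [latC]

/-- Integers whose difference is a difference of two numbers of `[0, 1)` are equal. [folklore] -/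
theorem int_eq_of_add_eq_add {a b : ℤ} {θ θ' : ℝ} (hθ : θ ∈ Ico (0 : ℝ) 1) (hθ' : θ' ∈ Ico (0 : ℝ) 1)
    (h : (a : ℝ) + θ = b + θ') : a = b := by
  have h1 : ((a - b : ℤ) : ℝ) = θ' - θ := by push_cast; linarith
  have h2 : ((a - b : ℤ) : ℝ) < 1 := by rw [h1]; linarith [hθ.1, hθ'.2]
  have h3 : (-1 : ℝ) < ((a - b : ℤ) : ℝ) := by rw [h1]; linarith [hθ.2, hθ'.1]
  have h2' : a - b < 1 := by exact_mod_cast h2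
  have h3' : -1 < a - b := by exact_mod_cast h3
  omega

/-- An integer plus a number of `[0, 1)` is an integer only trivially. [folklore] -/
theorem int_eq_of_add_eq {a b : ℤ} {θ : ℝ} (hθ : θ ∈ Ico (0 : ℝ) 1) (h : (a : ℝ) + θ = b) : a = b :=
  int_eq_of_add_eq_add hθ ⟨le_rfl, one_pos⟩ (by rw [h, add_zero])

/-- `a + θ = b - θ'` with `θ, θ' ∈ [0, 1)` forces `b = a` or `b = a + 1`. [folklore] -/
theorem int_eq_or_of_add_eq_sub {a b : ℤ} {θ θ' : ℝ} (hθ : θ ∈ Ico (0 : ℝ) 1) (hθ' : θ' ∈ Ico (0 : ℝ) 1)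
    (h : (a : ℝ) + θ = b - θ') : a = b ∨ b = a + 1 := by
  have h1 : ((b - a : ℤ) : ℝ) = θ + θ' := by push_cast; linarith
  have h2 : ((b - a : ℤ) : ℝ) < 2 := by rw [h1]; linarith [hθ.2, hθ'.2]
  have h3 : (0 : ℝ) ≤ ((b - a : ℤ) : ℝ) := by rw [h1]; linarith [hθ.1, hθ'.1]
  have h2' : b - a < 2 := by exact_mod_cast h2
  have h3' : 0 ≤ b - a := by exact_mod_cast h3
  omega

/-- **Two half-open unit lattice edges meet only if they share their source or are reverse to
each other.** If `v + θ dir k = v' + θ' dir k'` with `θ, θ' ∈ [0, 1)`, then `v = v'`, or the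
second edge is the first one reversed (`v' = v + dir k`, `k' = k + 2`). [folklore] -/
theorem eq_or_reverse_of_halfEdge_eq {v v' : ℤ × ℤ} {k k' : Fin 4} {θ θ' : ℝ} (hθ : θ ∈ Ico (0 : ℝ) 1)
    (hθ' : θ' ∈ Ico (0 : ℝ) 1)
    (h : latC v + θ • latC (RectLoop.dir k) = latC v' + θ' • latC (RectLoop.dir k')) :
    v = v' ∨ (v' = v + RectLoop.dir k ∧ k' = k + 2) := by
  have hre := congrArg Complex.re h
  have him := congrArg Complex.im h
  simp only [Complex.add_re, Complex.add_im, Complex.smul_re, Complex.smul_im, latC_re, latC_im,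
    smul_eq_mul] at hre him
  rw [Prod.ext_iff, Prod.ext_iff]
  obtain rfl | rfl | rfl | rfl := fin4_cases k <;> obtain rfl | rfl | rfl | rfl := fin4_cases k' <;>
    simp only [RectLoop.dir, Int.cast_one, Int.cast_zero, Int.cast_neg, mul_one, mul_zero, mul_neg,
      add_zero, Prod.fst_add, Prod.snd_add] at hre him ⊢
  -- (0,0)
  · left; exact ⟨int_eq_of_add_eq_add hθ hθ' hre, by exact_mod_cast him⟩
  -- (0,1)
  · left; exact ⟨int_eq_of_add_eq hθ hre, (int_eq_of_add_eq hθ' him.symm).symm⟩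
  -- (0,2)
  · rcases int_eq_or_of_add_eq_sub hθ hθ' (by rw [hre]; ring) with h1 | h1
    · left; exact ⟨h1, by exact_mod_cast him⟩
    · right; refine ⟨⟨by rw [h1], by exact_mod_cast him.symm⟩, by decide⟩
  -- (0,3)
  · left
    refine ⟨int_eq_of_add_eq hθ hre, ?_⟩
    have := int_eq_of_add_eq hθ' (a := v.2) (b := v'.2) (by linarith)
    -- careful: him : v.2 = v'.2 - θ'  ⇒ v.2 + θ' = v'.2
    exact this
  -- (1,0)
  · left; exact ⟨(int_eq_of_add_eq hθ' hre.symm).symm, int_eq_of_add_eq hθ him⟩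
  -- (1,1)
  · left; exact ⟨by exact_mod_cast hre, int_eq_of_add_eq_add hθ hθ' him⟩
  -- (1,2)
  · left
    refine ⟨?_, int_eq_of_add_eq hθ him⟩
    have := int_eq_of_add_eq hθ' (a := v.1) (b := v'.1) (by linarith)
    exact this
  -- (1,3)
  · rcases int_eq_or_of_add_eq_sub hθ hθ' (by rw [him]; ring) with h1 | h1
    · left; exact ⟨by exact_mod_cast hre, h1⟩
    · right; refine ⟨⟨by exact_mod_cast hre.symm, by rw [h1]⟩, by decide⟩
  -- (2,0)
  · rcases int_eq_or_of_add_eq_sub hθ' hθ (a := v'.1) (b := v.1) (by linarith) with h1 | h1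
    · left; exact ⟨h1.symm, by exact_mod_cast him⟩
    · right; refine ⟨⟨by rw [h1]; ring, by exact_mod_cast him.symm⟩, by decide⟩
  -- (2,1)
  · left
    refine ⟨?_, (int_eq_of_add_eq hθ' him.symm).symm⟩
    have := int_eq_of_add_eq hθ (a := v'.1) (b := v.1) (by linarith)
    exact this.symm
  -- (2,2)
  · left
    refine ⟨?_, by exact_mod_cast him⟩
    exact int_eq_of_add_eq_add hθ' hθ (a := v.1) (b := v'.1) (by linarith)
  -- (2,3)
  · left
    refine ⟨?_, ?_⟩
    · have := int_eq_of_add_eq hθ (a := v'.1) (b := v.1) (by linarith)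
      exact this.symm
    · have := int_eq_of_add_eq hθ' (a := v.2) (b := v'.2) (by linarith)
      exact this
  -- (3,0)
  · left
    refine ⟨(int_eq_of_add_eq hθ' hre.symm).symm, ?_⟩
    have := int_eq_of_add_eq hθ (a := v'.2) (b := v.2) (by linarith)
    exact this.symm
  -- (3,1)
  · rcases int_eq_or_of_add_eq_sub hθ' hθ (a := v'.2) (b := v.2) (by linarith) with h1 | h1
    · left; exact ⟨by exact_mod_cast hre, h1.symm⟩
    · right; refine ⟨⟨by exact_mod_cast hre.symm, by rw [h1]; ring⟩, by decide⟩
  -- (3,2)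
  · left
    refine ⟨?_, ?_⟩
    · have := int_eq_of_add_eq hθ' (a := v.1) (b := v'.1) (by linarith)
      exact this
    · have := int_eq_of_add_eq hθ (a := v'.2) (b := v.2) (by linarith)
      exact this.symm
  -- (3,3)
  · left
    refine ⟨by exact_mod_cast hre, ?_⟩
    exact int_eq_of_add_eq_add hθ' hθ (a := v.2) (b := v'.2) (by linarith)

end HalfEdges

/-! ### The boundary polygon -/

namespace DiscreteDobrushin

variable {D : DiscreteDobrushin} {d₀ : Site 2 × Fin 4}

/-- `meshPoint δ` is injective for `δ ≠ 0`. [folklore] -/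
theorem meshPoint_injective {δ : ℝ} (hδ : δ ≠ 0) : Function.Injective (meshPoint δ) := by
  intro x y h
  have hδ' : (δ : ℂ) ≠ 0 := by exact_mod_cast hδ
  rw [meshPoint_eq_mul_latC, meshPoint_eq_mul_latC] at h
  have h' := mul_left_cancel₀ hδ' h
  apply toZ2_injective
  rw [Prod.ext_iff]
  constructor
  · have := congrArg Complex.re h'; simpa [latC] using this
  · have := congrArg Complex.im h'; simpa [latC] using this

/-- **The boundary polygon's vertex list**: the mesh points of the sources of the darts
`bwalk d₀ t`, `t < P`, of one period of the boundary walk. [folklore] -/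
def bverts (hD : D.IsZdAdmissible) (h₀ : D.IsOutEdge d₀.1 d₀.2) : List ℂ :=
  (List.range (bperiod hD h₀)).map fun t => meshPoint D.δ (D.bwalk d₀ t).1

/-- The vertex list has one vertex per dart of the period. [folklore] -/
@[simp] theorem length_bverts (hD : D.IsZdAdmissible) (h₀ : D.IsOutEdge d₀.1 d₀.2) :
    (bverts hD h₀).length = bperiod hD h₀ := by
  simp [bverts]

/-- The vertices of the list. [folklore] -/
theorem getElem_bverts (hD : D.IsZdAdmissible) (h₀ : D.IsOutEdge d₀.1 d₀.2) {t : ℕ}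
    (ht : t < (bverts hD h₀).length) : (bverts hD h₀)[t] = meshPoint D.δ (D.bwalk d₀ t).1 := by
  simp [bverts]

/-- The cyclically next vertex is the head of the dart. [folklore] -/
theorem getElem_bverts_succ_mod (hD : D.IsZdAdmissible) (h₀ : D.IsOutEdge d₀.1 d₀.2) {t : ℕ}
    (ht : (t + 1) % (bverts hD h₀).length < (bverts hD h₀).length) :
    (bverts hD h₀)[(t + 1) % (bverts hD h₀).length] =
      meshPoint D.δ ((D.bwalk d₀ t).1 + cornerUnit (D.bwalk d₀ t).2) := by
  rw [getElem_bverts, length_bverts, bwalk_mod_bperiod, bwalk_fst_succ]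

/-- A point of the half-open edge `t` of the boundary polygon, unscaled. [folklore] -/
theorem eq_of_mem_icoSegment_bverts (hD : D.IsZdAdmissible) (h₀ : D.IsOutEdge d₀.1 d₀.2) {t : ℕ}
    (ht : t < (bverts hD h₀).length) {z : ℂ}
    (hz : z ∈ icoSegment (bverts hD h₀)[t]
      ((bverts hD h₀)[(t + 1) % (bverts hD h₀).length]'(Nat.mod_lt _ (by omega)))) :
    ∃ θ ∈ Ico (0 : ℝ) 1, z = (D.δ : ℂ) * (latC (toZ2 (D.bwalk d₀ t).1) +
      θ • latC (RectLoop.dir (D.bwalk d₀ t).2)) := by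
  obtain ⟨θ, hθ, rfl⟩ := hz
  refine ⟨θ, hθ, ?_⟩
  rw [getElem_bverts_succ_mod, getElem_bverts, meshPoint_eq_mul_latC, meshPoint_eq_mul_latC,
    toZ2_add_cornerUnit, latC_add, AffineMap.lineMap_apply_module']
  simp only [Complex.real_smul]
  ring

/-- **The boundary polygon of admissible data on a regular domain is a simple closed polygon.**
Consecutive vertices differ by a mesh step; two half-open edges meeting would share their
source (excluded by vertex-simplicity, `bwalk_fst_injOn`) or be reverse to each other (a
face-boundary edge is never traversed backwards, `bwalk_ne_reverse`). [folklore] -/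
theorem isSimpleClosedPolygon_bverts (hD : D.IsZdAdmissible) (h₀ : D.IsOutEdge d₀.1 d₀.2)
    (hΩo : IsOpen D.Ω) (hext : IsConnected (closure D.Ω)ᶜ) (hunb : ¬ Bornology.IsBounded (closure D.Ω)ᶜ)
    (hfr : frontier D.Ω ⊆ closure (closure D.Ω)ᶜ) : IsSimpleClosedPolygon (bverts hD h₀) := by
  have hδ := hD.delta_pos
  have hδ0 : (D.δ : ℂ) ≠ 0 := by exact_mod_cast hδ.ne'
  refine IsSimpleClosedPolygon.of_lt (by rw [length_bverts]; exact bperiod_pos hD h₀) ?_ ?_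
  · intro t ht heq
    rw [getElem_bverts_succ_mod, getElem_bverts] at heq
    have := meshPoint_injective hδ.ne' heq
    exact cornerUnit_ne_zero _ (add_left_cancel (a := (D.bwalk d₀ t).1) (by rw [add_zero]; exact this.symm))
  · intro s t hs ht hst
    rw [Set.disjoint_left]
    intro z hzs hzt
    obtain ⟨θ, hθ, hz1⟩ := eq_of_mem_icoSegment_bverts hD h₀ hs hzs
    obtain ⟨θ', hθ', hz2⟩ := eq_of_mem_icoSegment_bverts hD h₀ ht hzt
    rw [hz1] at hz2
    have h := mul_left_cancel₀ hδ0 hz2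
    rw [length_bverts] at hs ht
    rcases eq_or_reverse_of_halfEdge_eq hθ hθ' h with hv | ⟨hv, hk⟩
    · have := bwalk_fst_injOn hD h₀ hΩo hext hunb hfr hs ht (toZ2_injective hv)
      omega
    · rw [← toZ2_add_cornerUnit] at hv
      have hv' := toZ2_injective hv
      exact bwalk_ne_reverse h₀ (isOutEdge_bwalk h₀ s) t (Prod.ext hv' hk)

end DiscreteDobrushin


/-! ### The boundary cycle from the start corner; the end dart `e_b` -/

namespace DiscreteDobrushin

variable {D : DiscreteDobrushin}

/-- The start corner is a face-boundary dart (the edge `e_a` sourced at its `A`-end, inner face on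
the left). [cite: Smirnov2001, §2] -/
theorem isOutEdge_startCorner (hD : D.IsZdAdmissible) :
    D.IsOutEdge (startCorner hD).1 (startCorner hD).2 :=
  (isStartCorner_startCorner hD).isOutEdge

/-- The source of a face-boundary dart lies in `Ω_δ`. [cite: Smirnov2001, §2] -/
theorem IsOutEdge.fst_mem_meshDomain {x : Site 2} {k : Fin 4} (h : D.IsOutEdge x k) :
    x ∈ meshDomain D.Ω D.δ :=
  (discreteDomainGraph_adj_iff.1 (adj_of_isInnerFace_faceAt h.1 (Or.inl rfl))).2.1

/-- A face-boundary dart is determined by its edge. [folklore] -/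
theorem eq_of_isOutEdge_of_cSrc_eq {p q : Site 2 × Fin 4} (hp : D.IsOutEdge p.1 p.2)
    (hq : D.IsOutEdge q.1 q.2) (h : cSrc p = cSrc q) : p = q := by
  obtain ⟨x, k⟩ := p
  obtain ⟨y, k'⟩ := q
  simp only [cSrc] at h
  rcases Sym2.eq_iff.1 h with ⟨rfl, h2⟩ | ⟨h1, h2⟩
  · exact Prod.ext rfl (cornerUnit_injective (add_left_cancel h2))
  · exfalso
    -- the darts are reverse to each other
    rw [h1, add_assoc] at h2
    have h3 : cornerUnit k' + cornerUnit k = 0 := add_left_cancel (h2.trans (add_zero y).symm)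
    have hk : cornerUnit k = cornerUnit (k' + 2) := by
      rw [cornerUnit_add_two]; exact eq_neg_of_add_eq_zero_right h3
    have hk' := cornerUnit_injective hk
    simp only at hp hq
    rw [h1, hk'] at hp
    have := (isOutEdge_iff_isInEdge (y + cornerUnit k') (k' + 2)).1 hp
    rw [add_cornerUnit_add_cornerUnit_add_two, fin4_add_two_add_two'] at this
    exact hq.not_isInEdge this

/-- **The boundary cycle of admissible Dobrushin data**: the closed lattice walk of one period
of the left-hand boundary walk from the start corner `e_a`. [folklore] -/
def bcycle (hD : D.IsZdAdmissible) : ClosedWalk (bperiod hD (isOutEdge_startCorner hD)) :=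
  bloop 0 (bperiod hD (isOutEdge_startCorner hD)) (bperiod_pos _ _) (by rw [zero_add, bwalk_bperiod]; rfl)

section EndDart

variable {ω : Percolation.BondConfig (Site 2)}

/-- The last inner corner of the exploration of `ω` (at step `exitTime - 1`). [cite: Smirnov2001, §2] -/
def lastCorner (hD : D.IsZdAdmissible) (ω : Percolation.BondConfig (Site 2)) : Site 2 × Fin 4 :=
  cornerOrbit (D.bcBondConfig ω) (startCorner hD) (exitTime hD ω - 1)

/-- The face of the last corner is inner. [cite: Smirnov2001, §2] -/
theorem isInnerFace_lastCorner (hD : D.IsZdAdmissible) (ω : Percolation.BondConfig (Site 2)) :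
    D.IsInnerFace (cFace (lastCorner hD ω)) :=
  isInnerFace_of_lt_exitTime hD ω (Nat.sub_lt (exitTime_pos hD ω) one_pos)

/-- The corner after the last corner is the exit corner (non-inner face). [cite: Smirnov2001, §2] -/
theorem not_isInnerFace_next_lastCorner (hD : D.IsZdAdmissible) (ω : Percolation.BondConfig (Site 2)) :
    ¬ D.IsInnerFace (cFace (cornerOrbit (D.bcBondConfig ω) (startCorner hD) (exitTime hD ω - 1 + 1))) := by
  rw [Nat.sub_add_cancel (exitTime_pos hD ω)]
  exact not_isInnerFace_exitTime hD ω

/-- **The end dart `e_b` of the exploration of `ω`**, read as a face-boundary dart: the exit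
edge `cTgt (lastCorner)` oriented from its `B`-end to its `A`-end (it is targeted at its `A`-end,
`cornerOrbit_exit`). [cite: Smirnov2001, §2] -/
def ebDart' (hD : D.IsZdAdmissible) (ω : Percolation.BondConfig (Site 2)) : Site 2 × Fin 4 :=
  ((lastCorner hD ω).1 + cornerUnit ((lastCorner hD ω).2 + 1), (lastCorner hD ω).2 + 3)

/-- The end dart is a face-boundary dart. [cite: Smirnov2001, §2] -/
theorem isOutEdge_ebDart' (hD : D.IsZdAdmissible) (ω : Percolation.BondConfig (Site 2)) :
    D.IsOutEdge (ebDart' hD ω).1 (ebDart' hD ω).2 := by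
  obtain ⟨-, -, -, hIn⟩ := cornerOrbit_exit hD (isStartCorner_startCorner hD)
    (isInnerFace_lastCorner hD ω) (not_isInnerFace_next_lastCorner hD ω)
  change D.IsInEdge (lastCorner hD ω).1 ((lastCorner hD ω).2 + 1) at hIn
  unfold ebDart'
  rw [← fin4_add_one_add_two, isOutEdge_iff_isInEdge, add_cornerUnit_add_cornerUnit_add_two, fin4_add_two_add_two']
  exact hIn

/-- The edge of the end dart is the exit edge `e_b`. [cite: Smirnov2001, §2] -/
theorem cSrc_ebDart' (hD : D.IsZdAdmissible) (ω : Percolation.BondConfig (Site 2)) :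
    cSrc (ebDart' hD ω) = cTgt (lastCorner hD ω) := by
  unfold ebDart'
  rw [cSrc, cTgt, ← fin4_add_one_add_two, add_cornerUnit_add_cornerUnit_add_two, Sym2.eq_swap]

/-- The edge of the end dart is an `A`–`B` edge … [cite: Smirnov2001, §2] -/
theorem cSrc_ebDart'_mem (hD : D.IsZdAdmissible) (ω : Percolation.BondConfig (Site 2)) :
    cSrc (ebDart' hD ω) ∈ D.zdABEdges := by
  rw [cSrc_ebDart']
  exact cTgt_exit_mem_zdABEdges hD (isStartCorner_startCorner hD) (isInnerFace_lastCorner hD ω)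
    (not_isInnerFace_next_lastCorner hD ω)

/-- … distinct from `e_a`. [cite: Smirnov2001, §2] -/
theorem cSrc_ebDart'_ne (hD : D.IsZdAdmissible) (ω : Percolation.BondConfig (Site 2)) :
    cSrc (ebDart' hD ω) ≠ cSrc (startCorner hD) := by
  rw [cSrc_ebDart']
  exact cTgt_exit_ne_cSrc_start hD (isStartCorner_startCorner hD) (isInnerFace_lastCorner hD ω)
    (not_isInnerFace_next_lastCorner hD ω)

/-- `e_a` is an `A`–`B` edge. [cite: Smirnov2001, §2] -/
theorem cSrc_startCorner_mem (hD : D.IsZdAdmissible) : cSrc (startCorner hD) ∈ D.zdABEdges :=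
  cSrc_mem_zdABEdges (isStartCorner_startCorner hD).mem_zdArcA (isStartCorner_startCorner hD).mem_zdArcB
    (Or.inl (isOutEdge_startCorner hD))

/-- There are only two `A`–`B` edges: any two of them other than `e_a` coincide. [cite: Smirnov2001, §2] -/
theorem eq_of_mem_zdABEdges_of_ne (hD : D.IsZdAdmissible) {e e' : Sym2 (Site 2)} (he : e ∈ D.zdABEdges)
    (he' : e' ∈ D.zdABEdges) (hne : e ≠ cSrc (startCorner hD)) (hne' : e' ≠ cSrc (startCorner hD)) :
    e = e' := by
  obtain ⟨x, y, hxy, hS⟩ := Set.ncard_eq_two.1 hD.ncard_zdABEdges_eq_two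
  have ha := cSrc_startCorner_mem hD
  rw [hS] at he he' ha
  simp only [Set.mem_insert_iff, Set.mem_singleton_iff] at he he' ha
  rcases ha with ha | ha <;> rcases he with he | he <;> rcases he' with he' | he' <;> subst he he'
  all_goals first | rfl | exact absurd ha.symm hne | exact absurd ha.symm hne'

/-- **The end dart does not depend on the configuration.** [cite: Smirnov2001, §2] -/
theorem ebDart'_eq (hD : D.IsZdAdmissible) (ω ω' : Percolation.BondConfig (Site 2)) :
    ebDart' hD ω = ebDart' hD ω' :=
  eq_of_isOutEdge_of_cSrc_eq (isOutEdge_ebDart' hD ω) (isOutEdge_ebDart' hD ω')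
    (eq_of_mem_zdABEdges_of_ne hD (cSrc_ebDart'_mem hD ω) (cSrc_ebDart'_mem hD ω') (cSrc_ebDart'_ne hD ω)
      (cSrc_ebDart'_ne hD ω'))

end EndDart

/-- **The end dart `e_b`** (the `A`–`B` edge other than `e_a`, oriented as a face-boundary dart,
from its `B`-end to its `A`-end): the exit dart of every exploration (`ebDart'_eq`).
[cite: Smirnov2001, §2] -/
def ebDart (hD : D.IsZdAdmissible) : Site 2 × Fin 4 := ebDart' hD ∅

/-- The exit dart of every exploration is the end dart. [cite: Smirnov2001, §2] -/
theorem ebDart'_eq_ebDart (hD : D.IsZdAdmissible) (ω : Percolation.BondConfig (Site 2)) :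
    ebDart' hD ω = ebDart hD := ebDart'_eq hD ω ∅

/-- The end dart is a face-boundary dart. [cite: Smirnov2001, §2] -/
theorem isOutEdge_ebDart (hD : D.IsZdAdmissible) : D.IsOutEdge (ebDart hD).1 (ebDart hD).2 :=
  isOutEdge_ebDart' hD ∅

/-- The end dart differs from the start corner. [cite: Smirnov2001, §2] -/
theorem ebDart_ne_startCorner (hD : D.IsZdAdmissible) : ebDart hD ≠ startCorner hD := fun h =>
  cSrc_ebDart'_ne hD ∅ (by rw [← h]; rfl)

/-! ### Winding number one along the exploration; the end dart lies on the boundary cycle -/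

/-- Along any orbit from the start corner the vertex stays in `Ω_δ`. [cite: Smirnov2001, §2] -/
theorem cornerOrbit_startCorner_fst_mem (hD : D.IsZdAdmissible) (ω : Percolation.BondConfig (Site 2)) (n : ℕ) :
    (cornerOrbit (D.bcBondConfig ω) (startCorner hD) n).1 ∈ meshDomain D.Ω D.δ :=
  cornerOrbit_fst_mem_meshDomain (isOutEdge_startCorner hD).fst_mem_meshDomain n

section Regular

variable (hD : D.IsZdAdmissible) (hΩo : IsOpen D.Ω) (hext : IsConnected (closure D.Ω)ᶜ)
  (hunb : ¬ Bornology.IsBounded (closure D.Ω)ᶜ) (hfr : frontier D.Ω ⊆ closure (closure D.Ω)ᶜ)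

include hΩo hext hunb hfr

/-- **The faces of the exploration have winding number one** for the boundary cycle: the first
face is the left face of `e_a`; consecutive faces coincide or share an edge between two inner
faces, across which the boundary cycle does not pass. [cite: Smirnov2001, §2] -/
theorem W_bcycle_cFace_cornerOrbit (ω : Percolation.BondConfig (Site 2)) {n : ℕ} (hn : n < exitTime hD ω) :
    (bcycle hD).W (toZ2 (cFace (cornerOrbit (D.bcBondConfig ω) (startCorner hD) n))) = 1 := by
  induction n with
  | zero =>
    have := W_bloop_left_eq_one (i := 0) (m := bperiod hD (isOutEdge_startCorner hD))
      (hm := bperiod_pos _ _) (hcl := by rw [zero_add, bwalk_bperiod]; rfl) hD (isOutEdge_startCorner hD)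
      le_rfl hΩo hext hunb hfr (t := 0) (bperiod_pos _ _)
    exact this
  | succ n ih =>
    have hn' : n < exitTime hD ω := Nat.lt_of_succ_lt hn
    have ih' := ih hn'
    set p := cornerOrbit (D.bcBondConfig ω) (startCorner hD) n with hp
    have hin : D.IsInnerFace (cFace p) := isInnerFace_of_lt_exitTime hD ω hn'
    have hin' : D.IsInnerFace (cFace (cornerOrbit (D.bcBondConfig ω) (startCorner hD) (n + 1))) :=
      isInnerFace_of_lt_exitTime hD ω hn
    rw [cornerOrbit_succ] at hin' ⊢
    by_cases hmem : cTgt p ∈ D.bcBondConfig ω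
    · rw [← hp, cFace_nextCorner_of_mem hmem]; exact ih'
    · rw [← hp, cFace_nextCorner_of_not_mem hmem] at hin' ⊢
      -- the faces `k` and `k + 1` at `p.1` are both inner: the edge between them is avoided
      have key := W_bloop_eq_of_forall_ne (i := 0) (m := bperiod hD (isOutEdge_startCorner hD))
        (hm := bperiod_pos _ _) (hcl := by rw [zero_add, bwalk_bperiod]; rfl) (d₀ := startCorner hD)
        (x := p.1) (k := p.2 + 1) ?_ ?_
      · rw [fin4_add_one_add_three] at key
        change (bcycle hD).W _ = (bcycle hD).W (toZ2 (cFace p)) at key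
        rw [key]; exact ih'
      · intro t _ heq
        rw [zero_add] at heq
        have := isOutEdge_bwalk (isOutEdge_startCorner hD) t
        rw [heq] at this
        exact this.2 (by rw [fin4_add_one_add_three]; exact hin)
      · intro t _ heq
        rw [zero_add] at heq
        have := isOutEdge_bwalk (isOutEdge_startCorner hD) t
        rw [heq] at this
        have h2 := (isOutEdge_iff_isInEdge _ _).1 this
        rw [add_cornerUnit_add_cornerUnit_add_two, fin4_add_two_add_two'] at h2
        exact h2.2 hin'

/-- **The end dart lies on the boundary cycle**: its left face is the last face of the
exploration (winding number one), its right face the exit face (non-inner, winding number zero),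
so the cycle must pass along it. [cite: Smirnov2001, §2] -/
theorem exists_bwalk_eq_ebDart : ∃ t < bperiod hD (isOutEdge_startCorner hD),
    D.bwalk (startCorner hD) t = ebDart hD := by
  classical
  by_contra h
  simp only [not_exists, not_and] at h
  have h' : ∀ t, D.bwalk (startCorner hD) t ≠ ebDart hD := fun t ht =>
    h (t % bperiod hD (isOutEdge_startCorner hD)) (Nat.mod_lt _ (bperiod_pos _ _))
      (by rw [bwalk_mod_bperiod]; exact ht)
  set ω : Percolation.BondConfig (Site 2) := ∅
  set q := lastCorner hD ω with hq
  have heb : ebDart hD = (q.1 + cornerUnit (q.2 + 1), q.2 + 3) := rfl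
  -- left face of the end dart = last face of the exploration, right face = exit face
  have hleft : faceAt (ebDart hD).1 (ebDart hD).2 = cFace q := by
    rw [heb]
    show faceAt (q.1 + cornerUnit (q.2 + 1)) (q.2 + 3) = faceAt q.1 q.2
    rw [← fin4_add_one_add_two, faceAt_add_unit_add_two, fin4_add_one_add_three]
  have hright : faceAt (ebDart hD).1 ((ebDart hD).2 + 3) = faceAt q.1 (q.2 + 1) := by
    rw [heb]
    show faceAt (q.1 + cornerUnit (q.2 + 1)) (q.2 + 3 + 3) = faceAt q.1 (q.2 + 1)
    rw [fin4_add_three_add_three, ← fin4_add_one_add_one, faceAt_add_unit_succ]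
  have hW1 : (bcycle hD).W (toZ2 (cFace q)) = 1 :=
    W_bcycle_cFace_cornerOrbit hD hΩo hext hunb hfr ω (Nat.sub_lt (exitTime_pos hD ω) one_pos)
  have hexit : ¬ D.IsInnerFace (faceAt q.1 (q.2 + 1)) := by
    have h1 := not_isInnerFace_next_lastCorner hD ω
    obtain ⟨hclosed, -⟩ := cornerOrbit_exit hD (isStartCorner_startCorner hD)
      (isInnerFace_lastCorner hD ω) (not_isInnerFace_next_lastCorner hD ω)
    rwa [cornerOrbit_succ, cFace_nextCorner_of_not_mem hclosed] at h1
  have hW0 : (bcycle hD).W (toZ2 (faceAt q.1 (q.2 + 1))) = 0 :=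
    W_bloop_eq_zero_of_not_isInnerFace hD.delta_pos (isOutEdge_startCorner hD) hΩo hext hunb hfr hexit
      (isCorner_faceAt _ _) (cornerOrbit_startCorner_fst_mem hD ω _)
  -- if the cycle avoided the end dart, the two faces would have the same winding number
  have key := W_bloop_eq_of_forall_ne (i := 0) (m := bperiod hD (isOutEdge_startCorner hD))
    (hm := bperiod_pos _ _) (hcl := by rw [zero_add, bwalk_bperiod]; rfl) (d₀ := startCorner hD)
    (x := (ebDart hD).1) (k := (ebDart hD).2) (fun t _ => by rw [zero_add]; exact h' t)
    (fun t _ => by rw [zero_add]; exact bwalk_ne_reverse (isOutEdge_startCorner hD) (isOutEdge_ebDart hD) t)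
  change (bcycle hD).W (toZ2 (faceAt (ebDart hD).1 (ebDart hD).2)) =
    (bcycle hD).W (toZ2 (faceAt (ebDart hD).1 ((ebDart hD).2 + 3))) at key
  rw [hleft, hright, hW1, hW0] at key
  exact one_ne_zero key

open scoped Classical in
/-- **The position of the end dart on the boundary cycle.** [folklore] -/
def ebIdx : ℕ := Nat.find (exists_bwalk_eq_ebDart hD hΩo hext hunb hfr)

/-- The position of the end dart is within the period … [folklore] -/
theorem ebIdx_lt : ebIdx hD hΩo hext hunb hfr < bperiod hD (isOutEdge_startCorner hD) := by
  classical
  exact (Nat.find_spec (exists_bwalk_eq_ebDart hD hΩo hext hunb hfr)).1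

/-- … the dart there is the end dart … [folklore] -/
theorem bwalk_ebIdx : D.bwalk (startCorner hD) (ebIdx hD hΩo hext hunb hfr) = ebDart hD := by
  classical
  exact (Nat.find_spec (exists_bwalk_eq_ebDart hD hΩo hext hunb hfr)).2

/-- … and it is not the initial position (the end dart is not `e_a`). [folklore] -/
theorem ebIdx_pos : 0 < ebIdx hD hΩo hext hunb hfr := by
  rcases Nat.eq_zero_or_pos (ebIdx hD hΩo hext hunb hfr) with h | h
  · exfalso
    have := bwalk_ebIdx hD hΩo hext hunb hfr
    rw [h, bwalk_zero] at this
    exact ebDart_ne_startCorner hD this.symm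
  · exact h

/-! ### The polygonal Dobrushin domain of admissible data -/

/-- **The polygonal Dobrushin domain `(Ω_δ; a_δ, b_δ)` of admissible square-lattice Dobrushin
data on a regular domain**: the Jordan domain inside the boundary polygon of the union of the
inner faces explored from `e_a` (`polygonDomain` of `bverts`, traversed with the inner faces on
the left, from the `A`-end of `e_a`), with the marked boundary points `a_δ` = the midpoint of
`e_a` (parameter `1/(2P)`) and `b_δ` = the midpoint of `e_b` (parameter `(2 t_b + 1)/(2P)`,
`t_b = ebIdx`). This is the "polygonal domain `Ω^δ_ℂ` (union of tiles) corresponding to `Ω^δ`"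
with its marked points of Chelkak–Duminil-Copin–Hongler–Kemppainen–Smirnov, C. R. Math. 352
(2014), §2, for the tree's canonical discretisation (`DiscreteDobrushin`, `IsZdAdmissible`).
[cite: CDHKSCRAS2014, §2] -/
def faceDomain : DobrushinDomain where
  toJordanDomain := polygonDomain (bverts hD (isOutEdge_startCorner hD))
    (isSimpleClosedPolygon_bverts hD (isOutEdge_startCorner hD) hΩo hext hunb hfr)
  mark := ![1 / (2 * bperiod hD (isOutEdge_startCorner hD)),
    (2 * ebIdx hD hΩo hext hunb hfr + 1) / (2 * bperiod hD (isOutEdge_startCorner hD))]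
  strictMono_mark := by
    have hP : (0 : ℝ) < bperiod hD (isOutEdge_startCorner hD) := by exact_mod_cast bperiod_pos _ _
    have ht : (1 : ℝ) ≤ ebIdx hD hΩo hext hunb hfr := by exact_mod_cast ebIdx_pos hD hΩo hext hunb hfr
    refine Fin.strictMono_iff_lt_succ.2 fun k ↦ ?_
    fin_cases k
    simp only [Fin.zero_eta, Fin.isValue, Fin.castSucc_zero, Matrix.cons_val_zero, Fin.succ_zero_eq_one,
      Matrix.cons_val_one, Matrix.cons_val_fin_one]
    rw [div_lt_div_iff_of_pos_right (by positivity)]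
    linarith
  mark_mem k := by
    have hP : (0 : ℝ) < bperiod hD (isOutEdge_startCorner hD) := by exact_mod_cast bperiod_pos _ _
    have ht : (ebIdx hD hΩo hext hunb hfr : ℝ) + 1 ≤ bperiod hD (isOutEdge_startCorner hD) := by
      exact_mod_cast ebIdx_lt hD hΩo hext hunb hfr
    fin_cases k
    · simp only [Fin.zero_eta, Fin.isValue, Matrix.cons_val_zero, mem_Ico]
      refine ⟨by positivity, ?_⟩
      rw [div_lt_one (by positivity)]
      have : (1 : ℝ) ≤ bperiod hD (isOutEdge_startCorner hD) := by exact_mod_cast bperiod_pos _ _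
      linarith
    · simp only [Fin.mk_one, Fin.isValue, Matrix.cons_val_one, Matrix.cons_val_fin_one, mem_Ico]
      refine ⟨by positivity, ?_⟩
      rw [div_lt_one (by positivity)]
      linarith

/-- The carrier of the face domain is the polygonal Jordan domain of the boundary polygon.
[folklore] -/
theorem faceDomain_carrier : (faceDomain hD hΩo hext hunb hfr).carrier =
    (polygonDomain (bverts hD (isOutEdge_startCorner hD))
      (isSimpleClosedPolygon_bverts hD (isOutEdge_startCorner hD) hΩo hext hunb hfr)).carrier := rfl

/-- The boundary loop of the face domain is the boundary polygon. [folklore] -/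
theorem faceDomain_boundary : (faceDomain hD hΩo hext hunb hfr).boundary =
    polygonLoop (bverts hD (isOutEdge_startCorner hD)) := rfl

omit hΩo hext hunb hfr in
/-- The midpoint of an edge of the boundary polygon, as a value of the boundary loop.
[folklore] -/
theorem polygonLoop_bverts_midpoint {t : ℕ} (ht : t < bperiod hD (isOutEdge_startCorner hD)) :
    polygonLoop (bverts hD (isOutEdge_startCorner hD)) ((2 * t + 1) / (2 * bperiod hD (isOutEdge_startCorner hD))) =
      medialPoint D.δ (cSrc (D.bwalk (startCorner hD) t)) := by
  have hP : (0 : ℝ) < bperiod hD (isOutEdge_startCorner hD) := by exact_mod_cast bperiod_pos _ _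
  have hlen := length_bverts hD (isOutEdge_startCorner hD)
  have ht' : t < (bverts hD (isOutEdge_startCorner hD)).length := by rw [hlen]; exact ht
  have key := polygonLoop_apply_div ht' (θ := 1 / 2) ⟨by norm_num, by norm_num⟩
  rw [show (2 * (t : ℝ) + 1) / (2 * bperiod hD (isOutEdge_startCorner hD)) =
      ((t : ℝ) + 1 / 2) / (bverts hD (isOutEdge_startCorner hD)).length by
        rw [hlen]; field_simp, key,
    getElem_bverts_succ_mod, getElem_bverts, cSrc, medialPoint_mk, AffineMap.lineMap_apply_module']
  simp only [Complex.real_smul]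
  push_cast
  ring

/-- **The first marked point is `a_δ`, the midpoint of `e_a`.** [cite: CDHKSCRAS2014, §2] -/
theorem faceDomain_pt_zero :
    (faceDomain hD hΩo hext hunb hfr).pt 0 = medialPoint D.δ (cSrc (startCorner hD)) := by
  have := polygonLoop_bverts_midpoint hD (bperiod_pos _ _)
  rw [Nat.cast_zero, mul_zero, zero_add, bwalk_zero] at this
  rw [← this]
  rfl

/-- **The second marked point is `b_δ`, the midpoint of `e_b`.** [cite: CDHKSCRAS2014, §2] -/
theorem faceDomain_pt_one :
    (faceDomain hD hΩo hext hunb hfr).pt 1 = medialPoint D.δ (cSrc (ebDart hD)) := by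
  have := polygonLoop_bverts_midpoint hD (ebIdx_lt hD hΩo hext hunb hfr)
  rw [bwalk_ebIdx] at this
  rw [← this]
  rfl

end Regular

end DiscreteDobrushin


/-! ### Faces of winding number one lie inside the face domain -/

namespace DiscreteDobrushin

variable {D : DiscreteDobrushin}

/-- A point of a scaled unit lattice segment is not in any open cell. [folklore] -/
theorem not_mem_cell_of_mem_segment_meshPoint {δ : ℝ} (hδ : 0 < δ) {x : Site 2} {k : Fin 4} {z : ℂ}
    (hz : z ∈ segment ℝ (meshPoint δ x) (meshPoint δ (x + cornerUnit k))) (a b : ℤ) :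
    z ∉ Mesh.cell δ a b := by
  rw [meshPoint_eq_mul_latC, meshPoint_eq_mul_latC, ← ClosedWalk.image_mul_segment_latC] at hz
  obtain ⟨z', hz', rfl⟩ := hz
  have hadj : RectLoop.Adj (toZ2 x) (toZ2 (x + cornerUnit k)) := ⟨_, toZ2_add_cornerUnit _ _⟩
  have hcoord := coord_of_mem_segment_latC hadj hz'
  intro hcell
  rw [Mesh.mem_cell_iff] at hcell
  simp only [Complex.mul_re, Complex.mul_im, Complex.ofReal_re, Complex.ofReal_im, zero_mul,
    sub_zero, add_zero] at hcell
  obtain ⟨⟨h1, h2⟩, h3, h4⟩ := hcell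
  set P := toZ2 x
  rcases hcoord with ⟨hi, -, -, -⟩ | ⟨hr, -, -, -⟩
  · rw [hi] at h3 h4
    have h3' : (b : ℝ) < P.2 := by
      have := lt_of_mul_lt_mul_left h3 hδ.le; exact_mod_cast this
    have h4' : (P.2 : ℝ) < b + 1 := by
      have := lt_of_mul_lt_mul_left h4 hδ.le; exact_mod_cast this
    have : (b : ℤ) < P.2 := by exact_mod_cast h3'
    have : P.2 < b + 1 := by exact_mod_cast h4'
    omega
  · rw [hr] at h1 h2
    have h1' : (a : ℝ) < P.1 := by
      have := lt_of_mul_lt_mul_left h1 hδ.le; exact_mod_cast this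
    have h2' : (P.1 : ℝ) < a + 1 := by
      have := lt_of_mul_lt_mul_left h2 hδ.le; exact_mod_cast this
    have : (a : ℤ) < P.1 := by exact_mod_cast h1'
    have : P.1 < a + 1 := by exact_mod_cast h2'
    omega

section Regular

variable (hD : D.IsZdAdmissible) (hΩo : IsOpen D.Ω) (hext : IsConnected (closure D.Ω)ᶜ)
  (hunb : ¬ Bornology.IsBounded (closure D.Ω)ᶜ) (hfr : frontier D.Ω ⊆ closure (closure D.Ω)ᶜ)

/-- The boundary polygon misses every open cell. [folklore] -/
theorem disjoint_cell_range_polygonLoop_bverts (a b : ℤ) :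
    Disjoint (Mesh.cell D.δ a b) (range (polygonLoop (bverts hD (isOutEdge_startCorner hD)))) := by
  rw [Set.disjoint_left]
  intro z hz hz'
  rw [range_polygonLoop (List.ne_nil_of_length_pos (by rw [length_bverts]; exact bperiod_pos _ _))] at hz'
  simp only [Set.mem_iUnion] at hz'
  obtain ⟨k, hk⟩ := hz'
  rw [getElem_bverts_succ_mod, getElem_bverts] at hk
  exact not_mem_cell_of_mem_segment_meshPoint hD.delta_pos hk a b hz

/-- The scaled polygon of the boundary cycle lies on the boundary polygon. [folklore] -/
theorem strace_bcycle_subset :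
    (bcycle hD).strace D.δ ⊆ range (polygonLoop (bverts hD (isOutEdge_startCorner hD))) := by
  intro z hz
  obtain ⟨j, hj, hjz⟩ := (bcycle hD).mem_strace_iff.1 hz
  rw [range_polygonLoop (List.ne_nil_of_length_pos (by rw [length_bverts]; exact bperiod_pos _ _))]
  simp only [Set.mem_iUnion]
  have hj' : j < (bverts hD (isOutEdge_startCorner hD)).length := by rw [length_bverts]; exact hj
  refine ⟨⟨j, hj'⟩, ?_⟩
  rw [getElem_bverts_succ_mod, getElem_bverts, meshPoint_eq_mul_latC, meshPoint_eq_mul_latC]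
  rwa [show (bcycle hD).v j = toZ2 (D.bwalk (startCorner hD) j).1 by
      rw [bcycle, bloop_v_of_lt hj, zero_add],
    show (bcycle hD).v (j + 1) = toZ2 ((D.bwalk (startCorner hD) j).1 + cornerUnit (D.bwalk (startCorner hD) j).2) by
      rw [bcycle, bloop_v_succ, Nat.mod_eq_of_lt hj, zero_add]] at hjz

include hΩo hext hunb hfr in
/-- **Cells of faces of non-zero winding number lie inside the face domain**: such a cell misses
the polygon, and its complementary component is bounded — otherwise it would join the cell centre
to infinity off the scaled polygon and the winding number would vanish
(`ClosedWalk.W_eq_zero_of_joined_far`). [folklore] -/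
theorem cell_subset_faceDomain_of_W_ne_zero {F : Site 2} (hW : (bcycle hD).W (toZ2 F) ≠ 0) :
    Mesh.cell D.δ (F 0) (F 1) ⊆ (faceDomain hD hΩo hext hunb hfr).carrier := by
  intro z hz
  rw [faceDomain_carrier, mem_polygonDomain_iff]
  have hdis := disjoint_cell_range_polygonLoop_bverts hD (F 0) (F 1)
  refine ⟨Set.disjoint_left.1 hdis hz, ?_⟩
  by_contra hK
  apply hW
  apply (bcycle hD).W_eq_zero_of_joined_far (bperiod_pos _ _) hD.delta_pos
  intro R
  set K := connectedComponentIn (range (polygonLoop (bverts hD (isOutEdge_startCorner hD))))ᶜ z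
  obtain ⟨w, hwK, hwR⟩ : ∃ w ∈ K, R < ‖w‖ := by
    by_contra! h
    exact hK ((Metric.isBounded_closedBall (x := (0 : ℂ)) (r := R)).subset fun w hw => by simpa using h w hw)
  have hsub : (range (polygonLoop (bverts hD (isOutEdge_startCorner hD))))ᶜ ⊆ ((bcycle hD).strace D.δ)ᶜ :=
    Set.compl_subset_compl.2 (strace_bcycle_subset hD)
  have hw : w ∈ connectedComponentIn ((bcycle hD).strace D.δ)ᶜ z := connectedComponentIn_mono z hsub hwK
  -- the cell centre and `z` are in the same component off the scaled polygon
  have hdis' : Disjoint (Mesh.cell D.δ (F 0) (F 1)) ((bcycle hD).strace D.δ) :=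
    hdis.mono_right (strace_bcycle_subset hD)
  have hzc : z ∈ connectedComponentIn ((bcycle hD).strace D.δ)ᶜ (Mesh.cellCenter D.δ (F 0) (F 1)) :=
    (Mesh.convex_cell D.δ _ _).isPreconnected.subset_connectedComponentIn (Mesh.cellCenter_mem_cell hD.delta_pos _ _)
      (Set.disjoint_left.1 hdis') hz
  refine ⟨w, ?_, hwR⟩
  simp only [toZ2_mk]
  rw [connectedComponentIn_eq hzc]
  exact hw

include hΩo hext hunb hfr in
/-- **The faces of every exploration lie inside the face domain** (their open cells in the
domain, their closed cells in its closure). [cite: CDHKSCRAS2014, §2] -/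
theorem closure_cell_cornerOrbit_subset (ω : Percolation.BondConfig (Site 2)) {n : ℕ} (hn : n < exitTime hD ω) :
    closure (Mesh.cell D.δ ((cFace (cornerOrbit (D.bcBondConfig ω) (startCorner hD) n)) 0)
      ((cFace (cornerOrbit (D.bcBondConfig ω) (startCorner hD) n)) 1)) ⊆
      closure (faceDomain hD hΩo hext hunb hfr).carrier :=
  closure_mono (cell_subset_faceDomain_of_W_ne_zero hD hΩo hext hunb hfr
    (by rw [W_bcycle_cFace_cornerOrbit hD hΩo hext hunb hfr ω hn]; exact one_ne_zero))

/-- The medial point of an edge between two corners of a face lies in the closed cell of the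
face. [folklore] -/
theorem medialPoint_mem_closure_cell {δ : ℝ} (hδ : 0 < δ) {v w f : Site 2} (hv : IsCorner v f)
    (hw : IsCorner w f) : medialPoint δ s(v, w) ∈ closure (Mesh.cell δ (f 0) (f 1)) := by
  rw [medialPoint_mk]
  apply segment_subset_closure_cell_of_isCorner hδ hv hw
  rw [segment_eq_image_lineMap]
  refine ⟨1 / 2, ⟨by norm_num, by norm_num⟩, ?_⟩
  rw [AffineMap.lineMap_apply_module']
  simp only [Complex.real_smul]
  push_cast
  ring

include hΩo hext hunb hfr in
/-- **The medial vertices of every exploration lie in the closure of the face domain**: the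
`n`-th medial vertex (`n ≤ exitTime`) is the midpoint of a side of an explored inner face.
[cite: CDHKSCRAS2014, §2] -/
theorem medialPoint_cSrc_cornerOrbit_mem (ω : Percolation.BondConfig (Site 2)) {n : ℕ} (hn : n ≤ exitTime hD ω) :
    medialPoint D.δ (cSrc (cornerOrbit (D.bcBondConfig ω) (startCorner hD) n)) ∈
      closure (faceDomain hD hΩo hext hunb hfr).carrier := by
  rcases hn.lt_or_eq with hlt | heq
  · set p := cornerOrbit (D.bcBondConfig ω) (startCorner hD) n
    refine closure_cell_cornerOrbit_subset hD hΩo hext hunb hfr ω hlt ?_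
    exact medialPoint_mem_closure_cell hD.delta_pos (isCorner_cFace p)
      ((isCorner_add_faceAt_iff p.1 p.2 p.2).2 (Or.inl rfl))
  · -- the last medial vertex is the target edge of the last inner corner
    have hN : n = exitTime hD ω - 1 + 1 := by rw [heq, Nat.sub_add_cancel (exitTime_pos hD ω)]
    rw [hN, cSrc_cornerOrbit_succ]
    set p := cornerOrbit (D.bcBondConfig ω) (startCorner hD) (exitTime hD ω - 1)
    refine closure_cell_cornerOrbit_subset hD hΩo hext hunb hfr ω (Nat.sub_lt (exitTime_pos hD ω) one_pos) ?_
    exact medialPoint_mem_closure_cell hD.delta_pos (isCorner_cFace p)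
      ((isCorner_add_faceAt_iff p.1 (p.2 + 1) p.2).2 (Or.inr (fin4_add_one_add_three p.2).symm))

end Regular

/-! ### Jordan domains are regular -/

/-- **The carrier of a Jordan domain is regular**: it is open, its exterior `(closure Ω)ᶜ` is
connected and unbounded, and its frontier lies in the closure of the exterior (the Jordan curve
theorem, PROVED in the tree: `JordanDomain.exterior_of_JCT JordanCurveTheorem_holds`).
[cite: Mccleary2006, Ch. 9] -/
theorem regular_of_eq_carrier (J : JordanDomain) (hΩ : D.Ω = J.carrier) :
    IsOpen D.Ω ∧ IsConnected (closure D.Ω)ᶜ ∧ ¬ Bornology.IsBounded (closure D.Ω)ᶜ ∧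
      frontier D.Ω ⊆ closure (closure D.Ω)ᶜ := by
  obtain ⟨hconn, hfr, hunb⟩ := J.exterior_of_JCT Literature.Topology.PlaneTopology.JordanCurveTheorem_holds
  rw [hΩ]
  refine ⟨J.isOpen, hconn, hunb, ?_⟩
  rw [← hfr]
  exact frontier_subset_closure

end DiscreteDobrushin


/-! ### The exploration polyline lies in the closed face domain, from `a_δ` to `b_δ` -/

section PolylineRange

variable {E : Type*} [AddCommGroup E] [Module ℝ E] [TopologicalSpace E] [ContinuousAdd E]
  [ContinuousSMul ℝ E]

/-- **A polyline whose consecutive segments lie in `C` lies in `C`** (vertices `g 0, …, g M`).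
[folklore] -/
theorem range_polylineFrom_map_range_subset {C : Set E} : ∀ (M : ℕ) (g : ℕ → E), g 0 ∈ C →
    (∀ i < M, segment ℝ (g i) (g (i + 1)) ⊆ C) →
    Set.range (polylineFrom (g 0) ((List.range M).map fun i => g (i + 1))).2 ⊆ C
  | 0, g, h0, _ => by
    rintro _ ⟨t, rfl⟩
    simp only [List.range_zero, List.map_nil, polylineFrom_nil]
    show (Path.refl (g 0)) t ∈ C
    rw [Path.refl_apply]
    exact h0
  | M + 1, g, _, h => by
    rw [List.range_succ_eq_map, List.map_cons, List.map_map, polylineFrom_cons, Path.trans_range,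
      Path.range_segment]
    exact Set.union_subset (h 0 (Nat.succ_pos M)) (range_polylineFrom_map_range_subset M (fun i => g (i + 1))
      (h 0 (Nat.succ_pos M) (right_mem_segment _ _ _)) (fun i hi => h (i + 1) (by omega)))

/-- The list `[g 0, …, g M]` in head–tail form. [folklore] -/
theorem map_range_succ_eq_cons {α : Type*} (g : ℕ → α) (M : ℕ) :
    (List.range (M + 1)).map g = g 0 :: (List.range M).map fun i => g (i + 1) := by
  rw [List.range_succ_eq_map, List.map_cons, List.map_map]
  rfl

/-- The polyline through `g 0, …, g M` lies in `C` if `g 0 ∈ C` and all its segments do.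
[folklore] -/
theorem range_polyline_map_range_subset {C : Set E} (M : ℕ) (g : ℕ → E) (h0 : g 0 ∈ C)
    (h : ∀ i < M, segment ℝ (g i) (g (i + 1)) ⊆ C) :
    Set.range (polyline ((List.range (M + 1)).map g)) ⊆ C := by
  rw [map_range_succ_eq_cons]
  exact range_polylineFrom_map_range_subset M g h0 h

/-- The polyline through `g 0, …, g M` starts at `g 0`. [folklore] -/
theorem polyline_map_range_apply_zero (M : ℕ) (g : ℕ → E) :
    polyline ((List.range (M + 1)).map g) 0 = g 0 := by
  rw [map_range_succ_eq_cons, polyline_apply_zero]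

/-- The polyline through `g 0, …, g M` ends at `g M`. [folklore] -/
theorem polyline_map_range_apply_one (M : ℕ) (g : ℕ → E) :
    polyline ((List.range (M + 1)).map g) 1 = g M := by
  rw [map_range_succ_eq_cons, polyline_apply_one]
  cases M with
  | zero => simp
  | succ M =>
    rw [List.getLast_cons (by simp), List.getLast_eq_getElem]
    simp

end PolylineRange

namespace DiscreteDobrushin

variable {D : DiscreteDobrushin}

/-- The medial exploration list as the list of the sources of the orbit corners.
[cite: Smirnov2001, §2] -/
theorem medialExploration_map_eq (hD : D.IsZdAdmissible) (ω : Percolation.BondConfig (Site 2)) :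
    (medialExploration D ω).map (medialPoint D.δ) = (List.range (exitTime hD ω + 1)).map
      fun i => medialPoint D.δ (cSrc (cornerOrbit (D.bcBondConfig ω) (startCorner hD) i)) := by
  rw [medialExploration_eq_explorationList hD ω, explorationList, List.map_map]
  rfl

section Regular

variable (hD : D.IsZdAdmissible) (hΩo : IsOpen D.Ω) (hext : IsConnected (closure D.Ω)ᶜ)
  (hunb : ¬ Bornology.IsBounded (closure D.Ω)ᶜ) (hfr : frontier D.Ω ⊆ closure (closure D.Ω)ᶜ)

include hΩo hext hunb hfr

/-- The segment between two consecutive medial vertices of an exploration lies in the closure of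
the face domain (both are midpoints of sides of the explored face in between).
[cite: CDHKSCRAS2014, §2] -/
theorem segment_medialPoint_cornerOrbit_subset (ω : Percolation.BondConfig (Site 2)) {n : ℕ}
    (hn : n < exitTime hD ω) :
    segment ℝ (medialPoint D.δ (cSrc (cornerOrbit (D.bcBondConfig ω) (startCorner hD) n)))
      (medialPoint D.δ (cSrc (cornerOrbit (D.bcBondConfig ω) (startCorner hD) (n + 1)))) ⊆
      closure (faceDomain hD hΩo hext hunb hfr).carrier := by
  set p := cornerOrbit (D.bcBondConfig ω) (startCorner hD) n
  refine Set.Subset.trans ?_ (closure_cell_cornerOrbit_subset hD hΩo hext hunb hfr ω hn)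
  apply (Mesh.convex_cell D.δ _ _).closure.segment_subset
  · exact medialPoint_mem_closure_cell hD.delta_pos (isCorner_cFace p)
      ((isCorner_add_faceAt_iff p.1 p.2 p.2).2 (Or.inl rfl))
  · rw [cornerOrbit_succ, cSrc_nextCorner]
    exact medialPoint_mem_closure_cell hD.delta_pos (isCorner_cFace p)
      ((isCorner_add_faceAt_iff p.1 (p.2 + 1) p.2).2 (Or.inr (fin4_add_one_add_three p.2).symm))

/-- **The exploration polyline of every configuration lies in the closure of the face domain.**
[cite: CDHKSCRAS2014, §2] -/
theorem range_medialExplorationCurve_subset (ω : Percolation.BondConfig (Site 2)) :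
    Set.range (medialExplorationCurve D ω) ⊆ closure (faceDomain hD hΩo hext hunb hfr).carrier := by
  rw [medialExplorationCurve, medialExploration_map_eq hD]
  exact range_polyline_map_range_subset _ _
    (medialPoint_cSrc_cornerOrbit_mem hD hΩo hext hunb hfr ω (Nat.zero_le _))
    fun i hi => segment_medialPoint_cornerOrbit_subset hD hΩo hext hunb hfr ω hi

/-- **The exploration polyline starts at `a_δ = pt 0` of the face domain.** [cite: CDHKSCRAS2014, §2] -/
theorem medialExplorationCurve_apply_zero (ω : Percolation.BondConfig (Site 2)) :
    medialExplorationCurve D ω 0 = (faceDomain hD hΩo hext hunb hfr).pt 0 := by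
  rw [faceDomain_pt_zero, medialExplorationCurve, medialExploration_map_eq hD, polyline_map_range_apply_zero]
  rfl

/-- **The exploration polyline ends at `b_δ = pt 1` of the face domain.** [cite: CDHKSCRAS2014, §2] -/
theorem medialExplorationCurve_apply_one (ω : Percolation.BondConfig (Site 2)) :
    medialExplorationCurve D ω 1 = (faceDomain hD hΩo hext hunb hfr).pt 1 := by
  rw [faceDomain_pt_one, medialExplorationCurve, medialExploration_map_eq hD, polyline_map_range_apply_one,
    ← ebDart'_eq_ebDart hD ω, cSrc_ebDart', lastCorner, ← cSrc_cornerOrbit_succ,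
    Nat.sub_add_cancel (exitTime_pos hD ω)]

end Regular

end DiscreteDobrushin


/-! ### The face domain lies in `closure Ω`: the inputs (B), (K2) of kernel convergence -/

namespace DiscreteDobrushin

variable {D : DiscreteDobrushin}

section Regular

variable (hD : D.IsZdAdmissible) (hΩo : IsOpen D.Ω) (hext : IsConnected (closure D.Ω)ᶜ)
  (hunb : ¬ Bornology.IsBounded (closure D.Ω)ᶜ) (hfr : frontier D.Ω ⊆ closure (closure D.Ω)ᶜ)

include hΩo hext hunb hfr

/-- **The face domain lies in `closure Ω`**: the exterior `(closure Ω)ᶜ` is connected,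
unbounded and misses the boundary polygon (which runs inside `closure Ω`), so it lies in the
unbounded complementary component of the polygon, off the inside. [folklore] -/
theorem faceDomain_carrier_subset_closure :
    (faceDomain hD hΩo hext hunb hfr).carrier ⊆ closure D.Ω := by
  intro z hz
  by_contra hzΩ
  rw [faceDomain_carrier, mem_polygonDomain_iff] at hz
  obtain ⟨-, hbdd⟩ := hz
  -- the polygon lies in `closure Ω`
  have hpoly : range (polygonLoop (bverts hD (isOutEdge_startCorner hD))) ⊆ closure D.Ω := by
    rw [range_polygonLoop (List.ne_nil_of_length_pos (by rw [length_bverts]; exact bperiod_pos _ _))]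
    simp only [Set.iUnion_subset_iff]
    intro k
    rw [getElem_bverts_succ_mod, getElem_bverts]
    set p := D.bwalk (startCorner hD) k
    exact segment_subset_closure_of_isInnerFace (E := D) (isOutEdge_bwalk (isOutEdge_startCorner hD) k).1
      (isCorner_faceAt p.1 p.2) ((isCorner_add_faceAt_iff p.1 p.2 p.2).2 (Or.inl rfl)) (cSrc_mem_edgeSet p)
  -- the exterior lies in the component of `z`, which is then unbounded
  have hsub : (closure D.Ω)ᶜ ⊆ connectedComponentIn (range (polygonLoop (bverts hD (isOutEdge_startCorner hD))))ᶜ z :=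
    hext.isPreconnected.subset_connectedComponentIn hzΩ (Set.compl_subset_compl.2 hpoly)
  exact hunb (hbdd.subset hsub)

/-- **(K2) for face domains**: no disc about a point off `Ω` lies in the face domain (such a disc
contains exterior points, which are off `closure Ω ⊇` the face domain). [folklore] -/
theorem not_ball_subset_faceDomain {w : ℂ} (hw : w ∉ D.Ω) {r : ℝ} (hr : 0 < r) :
    ¬ ball w r ⊆ (faceDomain hD hΩo hext hunb hfr).carrier := by
  intro h
  obtain ⟨x, hxb, hxE⟩ := Mesh.exists_mem_exterior_of_isOpen hΩo hfr Metric.isOpen_ball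
    (Metric.mem_ball_self hr) hw
  exact hxE (faceDomain_carrier_subset_closure hD hΩo hext hunb hfr (h hxb))

/-- **(B) for face domains**: the face domain lies in any disc containing `closure Ω`. [folklore] -/
theorem faceDomain_carrier_subset_of_closure_subset {S : Set ℂ} (hS : closure D.Ω ⊆ S) :
    (faceDomain hD hΩo hext hunb hfr).carrier ⊆ S :=
  (faceDomain_carrier_subset_closure hD hΩo hext hunb hfr).trans hS

end Regular

end DiscreteDobrushin

end Literature.Probability.LatticeModels
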